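import Literature.MathematicalPhysics.QuantumFieldTheory.Balaban1983to89.B1Eq324BenfattoClassSectEMemberPrecisionDoorRecordV4PPivotLines
import Literature.MathematicalPhysics.QuantumFieldTheory.Balaban1983to89.B1Eq324BenfattoClassSectEMemberJRowCompositionAtNode00

/-!
# `Balaban1983to89.B1Eq324BenfattoClassSectEMemberPrecisionDoorRecordV4PAdjCurrent` — THE 𝒥-ROW ALONG (3.136) AT PRINT's `H₁(U)` (SECT. D COMPOSITES FED `G′_phys`)
# UNDER A DISPLAYED PIN OF THE SECT.-E LETTER `⟨D̃⁽²⁾·,J⟩`, AND THE STAR DOORS OF RECORD AT THE v4P LETTERS WITH BOTH N06-SIDE ROWS BY NAME (seat dag-n08-d g41,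
# INTENT-102 = CHECK-M (r2) on the consumer side, without a new letter; node N08 [Balaban1985UV3], row `h324c`)

statement-level companion of published sources with citation tags; every declaration here is a theorem; nothing here is a claim about the
Yang–Mills mass gap

T. Bałaban, *Propagators for lattice gauge theories in a background field*, Commun. Math. Phys. **99** (1985) 389–434 [Balaban1985BackgroundPropagators] (= [B9]):
(3.129) p. 421 (`H₁ = G₁Q*(QG₁Q*)⁻¹`), (3.132)–(3.136) p. 422, (3.155)–(3.158) pp. 427–428 (p. 428 (3.156): the `J`-term `⟨D̃⁽²⁾B, J⟩` of `Δ_k`; p. 427: *«the function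
D̃⁽²⁾(B) is a quadratic polynomial in B with properties similar to C⁽²⁾(A), only restricted to unit blocks»*; p. 419: *«the function J = D*η⁻²Im ∂U is small, if U
satisfies the condition (3.36)»*); *Averaging operations for lattice gauge theories*, CMP **98** (1985) 17–51 [Balaban1985Averaging] (= [5]), (125)–(126) p. 36, (136)
p. 39; [Balaban1984PropagatorsII] (= [4]) (2.3) p. 224, Lemma 2.4 p. 245, (2.149) p. 249; [Balaban1985UV3] (24) p. 262; [Balaban1982Higgs1] (3.24) p. 616; [BenfattoEtAl1978]
Lemma (4.5)–(4.7) p. 152.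

WHY THIS MODULE (cell `pub-ymgap`, seat `dag-n08-d` gen 41, INTENT-102; CHECK-M memo `N08-CHECK-M-RECORD-g41.md` (r2)).  The 𝒥-row editions «along (3.136)» of the (3.24)
door (`…JRowCompositionAtNode00` §5–§6 p678684∕p680120, `…PrecisionDoorRowsByNameStar` p705447) read def-Y's v8 Sect.-E letter `sectEYWithDt2`, whose `D2J := d2JOfY …
(GpY parSymY) …` is built on the v4 record's `H₁` — the Sect. D composite fed the LATTICE site propagator, not print's `H₁(U)` at `U ≠ 1` (def-Y FILE 28
`Node00.OpsYGpUnits`).  A `…P` letter at `GpPhysY` is node00-def-Y's to define ((r2), open).  This file needs none: every lemma of `Node00.OpsYD2JForm` §1–§2 and of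
`…JRowCompositionAtNode00` §5 is GENERIC in the tables `(parS, parB, Gp, Δ2, D)` of `d2JOfY`, so the 𝒥-row is proved for ANY Sect.-E letter record `𝔢` under the
DISPLAYED PIN `𝔢.D2J U = d2JOfY (trDualMatY N) i parS parB Gp Δ2 D U` — the equation that says «the `⟨D̃⁽²⁾·,J⟩` letter IS [5]'s form (3.156) built on `H₁ = H1Y i parS parB Gp Δ2`,
the residual `Δ2` and the supplier's `D̃⁽²⁾ = D`» (for def-Y's v8 letter at `Gp := GpY` it is `sectEYWithDt2_D2J`, `rfl`; for a future `…P` letter at `GpPhysY` it will be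
`rfl` again) — and the doors instantiate it at PRINT's tables `parSymY ∕ parBY ∕ GpPhysY (parSymY) ∕ (𝔯 x).Δ2 ∕ (𝔡₂ x).form`, the ones node N06's certificate reads.
* §1 ★★ `JRowPrint_of_adjCurrent_at_pin` — p680120's `JRowPrint_sectEYWithDt2_of_adjCurrent_at` VERBATIM with the record face `sectEYWithDt2_D2J` replaced by the pin
  hypothesis and `GpY` by a generic `Gp`: for ONE pair of bonds, `‖(η^{d+1}•(a + 𝔢.D2J U))(δ_v⊗E)(u)‖ ≤ (θ.b₁ + 2N³·j₁·C₂·e^{δr₂})‖E‖e^{−δ|y_u−y_v|}` GIVEN (i†) the print-unit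
  sup of the adjoint current `η^{d+1}‖(H₁(U)†J(U))(z)‖ ≤ j₁` on a support predicate `S` (node N06's (3.136) content), (ii-out) the output support of `D̃⁽²⁾(U; δ_v⊗E, δ_u⊗·)`
  in `S`, (ii) argument-locality `r₂` and size `C₂` of `D̃⁽²⁾`; ★★ `JRowPrint_of_adjCurrent_onΛst_pin` — the door's binder order, (ii-out) on STAR pairs only (p705447 §1's shape).
* §2 ★★★ `eq324_CsDeltaCPstY_lettersYOfRecordV4P_sectEStYOfRecordV7_trBasis_of_ineq3132_of_adjCurrentP_of_pivotLines_onΛst_on_unit` — the star door of record at the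
  v4P letters (`…PrecisionDoorRecordV4PPivotLines` §2, p708611) with BOTH node-N06-side rows BY NAME at print's objects: the P-row := [B9] (3.132) for the `ν`-read
  `(QG₁Q*)⁻¹` of `opsYNuStOfRecordV4PE`, the 𝒥-row := §1 at `H₁ := H1Y … (GpPhysY …) (𝔯 x).Δ2` under the displayed pin; regime: `G ≤ U(N)`, `G`-valued `U`, the averaged
  field `δ_V`-small on the pivot lines of the bad-source star corners (`ℓ·2δ_V < 1`); displayed per background besides: [5]'s reality `IsSymmTr ((𝔯 x).Δ2 U)` ∕
  `IsSymmTr ((𝔢₀ x).D2J U)`, (b†) the adjoint-current sup on `S`, (c-out)∕(c) the `D̃⁽²⁾` rows, the Δ_k-row `γ₀` (G-B9-09).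
* §2 (cont.) ★★★ the FAMILY FORM at print's class `bg9YP` (`h26 : B9.Stmt3132Printed … (siteKernelP ∘ (opsYNuStOfRecordV4PE …).QG[1]Qinv)`, print's thresholds, ONE rate `δ`) and
  ★★★★ `…_of_b9LeafX_of_adjCurrentP_of_pivotLines_onΛst_on_unit` — MODULO NODE N06's SOCKET OF RECORD `h06 : B9LeafX (Y9OfRecordP N θ M⋆ (opsYNuStOfRecordV4PE N θ M⋆ 𝔯 𝔢st 𝔴 𝔈))`
  (`h26 := h06.s3132`); what node N06's leaf does NOT carry and stays displayed: (b†) ((3.136) is inside the proof of Thm 3.12, not a numbered statement), [5]'s letter rows,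
  the pin, the Δ_k-row `γ₀`.
* §1c ★★ [5]'s reality AT PRINT's TABLES: `GpPhysY_parSymY_isRealOpY`, `d2JOfY_GpPhysY_isRealOpY_of_real`, `d2JOfY_GpPhysY_isSymmTr_of_real` (def-Y's
  `sectEYWithDt2_D2J_isRealOpY ∕ _isSymmTr` with `GpY ↦ GpPhysY`; `H1Y_isRealOpY`, `d2JOfY_star_of_unitary`, `trPairY_d2JOfY_symm'` are generic in the site propagator).
* §3 ★★★ over `𝔯 := resYOfC2 𝔠`: the `_ofC2` editions of §2 (per background, family at `bg9YP`, ★★★★ modulo node N06's socket) with the two reality rows READ FROM [5]'s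
  letter properties `C⁽²⁾(U; A⋆, A′⋆) = C⁽²⁾(U; A, A′)⋆`, `D̃⁽²⁾(U; B⋆, B′⋆) = D̃⁽²⁾(U; B, B′)⋆` — seat n08-d's p705447 §2–§3 displayed content, every row now at print's objects.

HONEST SCOPE.  Count-neutral compositions BY NAME over def-Y's letters (`d2JOfY`, `H1Y`, `GpPhysY`, `trAdjY`, `JY`, `aY`) and this lineage's rows; no estimate of [B9] ∕ [4] ∕
[5] ∕ [BenfattoEtAl1978] ∕ [Balaban1985UV3] is asserted; the pin is a displayed EQUATION (no definition is made or changed here); (b†), [5]'s `D̃⁽²⁾` rows and reality, the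
Δ_k-row `γ₀` stay displayed; the IDENT for row `h324c` is NOT made; node N06 ∕ N08 NOT discharged; one finite 𝕋^{d+1} programme — nothing about d = 4 specifically, the
continuum, OS axioms, a mass gap or the Clay problem.  No `sorry`, no `def`, no `instance`, no `notation`.
-/

noncomputable section

open MeasureTheory Finset Matrix
open scoped Matrix.Norms.L2Operator

namespace Literature.MathematicalPhysics.QuantumFieldTheory.Balaban1983to89.B1Eq324BenfattoClassSectEMemberPrecisionDoorRecordV4PAdjCurrent

open Literature.MathematicalPhysics.QuantumFieldTheory
open Literature.MathematicalPhysics.QuantumFieldTheory.Balaban1983to89.B1Eq324BenfattoLemma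
open Literature.MathematicalPhysics.QuantumFieldTheory.Balaban1983to89.Node00
open Literature.MathematicalPhysics.QuantumFieldTheory.Balaban1983to89.DagBinding (B9LeafX)
open B6KLevelCensusIndexV1 (KIdx)
open B6BondElimination (unitVec)
open B9PinMembersKLevelV1 (MemberY geo9Y bg9Y)
open B9BackgroundsKLevelV1P (bg9YP)
open B9PinCarriersKLevelV1P (siteKernelP)
open B9PinGeometryKLevelV1 (unitDistY)
open B9Thm314WholePinGeometry (unitDistY_self)
open B9Thm311ReadingCoords (trIP IsSymmTr)
open B9CoReadingCoordsTranspose (trReForm TrIdx trBasis)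
open B7Prop2Explicit (unitaryUnits)
open B7Prop2SpecialUnitary (specialUnitaryUnits specialUnitaryUnits_le_unitaryUnits)
open B1Eq324BenfattoClassSectEMemberJRowScaleAtNode00 (aY_single_of_ne norm_etaD_smul_aY_single_le inv_pow_pow_pos)
open B1Eq324BenfattoClassSectEMemberJRowCompositionAtNode00 (mul_norm_d2JOfY_single_le_exp_of_adjCurrent KJadj_nonneg)
open B1Eq324BenfattoClassSectEMemberPrecisionDoorRecordV4PPivotLines
  (eq324_CsDeltaCPstY_lettersYOfRecordV4P_sectEStYOfRecordV7_trBasis_of_ineq3132_of_pivotLines_onΛst_on_unit)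

variable {N : ℕ}

/-! ## §1  The print-unit 𝒥-row from the adjoint current, for ANY Sect.-E letter record under the displayed PIN of its `⟨D̃⁽²⁾·,J⟩` letter (generic tables) -/

section JRowPin

variable (θ : Stage3Params) (Mstar' : ℕ) (𝔡₂ : Dt2Y N θ Mstar')

/-- ★★ **THE PRINT-UNIT `𝒥`-ROW AT ONE PAIR OF BONDS, FROM THE ADJOINT CURRENT, FOR ANY SECT.-E LETTER RECORD `𝔢` UNDER THE PIN `𝔢.D2J U = d2JOfY … parS parB Gp Δ2 D̃⁽²⁾ U`**
(generic tables; p680120 `JRowPrint_sectEYWithDt2_of_adjCurrent_at` verbatim with `sectEYWithDt2_D2J ↦ hpin`, `GpY ↦ Gp`): `‖(η^{d+1}•(a + 𝔢.D2J U))(δ_v⊗E)(u)‖ ≤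
(θ.b₁ + 2N³·j₁·C₂·e^{δr₂})·‖E‖·e^{−δ|y_u−y_v|}` given (i†) `S z → η^{d+1}·‖(H₁(U)†J(U))(z)‖ ≤ j₁` for `H₁ := H1Y i parS parB Gp Δ2`, (ii-out) the output support of
`D̃⁽²⁾(U; δ_v⊗E, δ_u⊗a)` in `S`, (ii) argument-locality radius `r₂` and size `C₂` of `D̃⁽²⁾`; the `a`-part by `norm_etaD_smul_aY_single_le` (`2 ≤ d+1`).
[cite: Balaban1985BackgroundPropagators, (3.156) p.428, (3.136) p.422, (3.129) p.421, (3.155) p.427; Balaban1985Averaging, (136) p.39; Balaban1984PropagatorsII, (2.149) p.249] -/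
theorem JRowPrint_of_adjCurrent_at_pin (hD : 2 ≤ θ.d₆ + 1) (x : MemberY θ.d₆ θ.ℓ₆ θ.hd' θ.hL' θ.b₀ θ.b₁ Mstar') [DecidableEq (IBondY x.toKIdx)]
    (𝔢 : SectELettersY (Matrix (Fin N) (Fin N) ℂ) x) (parS : SiteParY (Matrix (Fin N) (Fin N) ℂ) x.toKIdx) (parB : BondParY (Matrix (Fin N) (Fin N) ℂ) x.toKIdx)
    (Gp : SiteOpY (Matrix (Fin N) (Fin N) ℂ) x.toKIdx) (Δ2 : BondOpY (Matrix (Fin N) (Fin N) ℂ) x.toKIdx)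
    (U : CfgY (Matrix (Fin N) (Fin N) ℂ) x.toKIdx) (S : IBondY x.toKIdx → Prop) {j₁ C₂ r₂ δ : ℝ} (hj₁ : 0 ≤ j₁) (hC₂ : 0 ≤ C₂) (hδ : 0 ≤ δ)
    (hpin : 𝔢.D2J U = d2JOfY (trDualMatY N) x.toKIdx parS parB Gp Δ2 (𝔡₂ x).form U)
    (hHJ : ∀ z, S z → ((((θ.ℓ₆ + 1 : ℕ) : ℝ)) ^ x.k)⁻¹ ^ (θ.d₆ + 1) * ‖trAdjY (trDualMatY N) (H1Y x.toKIdx parS parB Gp Δ2 U) (JY x.toKIdx U) z‖ ≤ j₁)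
    (u v : IBondY x.toKIdx) (E : Matrix (Fin N) (Fin N) ℂ)
    (hDsupp : ∀ (a : Matrix (Fin N) (Fin N) ℂ) (z : IBondY x.toKIdx), (𝔡₂ x).form U (Pi.single v E) (Pi.single u a) z ≠ 0 → S z)
    (hDloc : ∀ a : Matrix (Fin N) (Fin N) ℂ, r₂ < unitDistY x u v → (𝔡₂ x).form U (Pi.single v E) (Pi.single u a) = 0)
    (hDsz : ∀ a : Matrix (Fin N) (Fin N) ℂ, ∑ z, ‖(𝔡₂ x).form U (Pi.single v E) (Pi.single u a) z‖ ≤ C₂ * ‖E‖ * ‖a‖) :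
    ‖(((((((θ.ℓ₆ + 1 : ℕ) : ℝ)) ^ x.k)⁻¹ ^ (θ.d₆ + 1) : ℝ) : ℂ) • (aY x.toKIdx + 𝔢.D2J U)).restrictScalars ℝ (Pi.single v E) u‖ ≤
      (θ.b₁ + 2 * (N : ℝ) ^ 3 * j₁ * C₂ * Real.exp (δ * r₂)) * ‖E‖ * Real.exp (-(δ * unitDistY x u v)) := by
  have hb₁ : 0 ≤ θ.b₁ := θ.hb.1.le.trans θ.hb.2
  have hlam : (0 : ℝ) ≤ ((((θ.ℓ₆ + 1 : ℕ) : ℝ)) ^ x.k)⁻¹ ^ (θ.d₆ + 1) := (inv_pow_pow_pos x).le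
  rw [LinearMap.restrictScalars_apply, LinearMap.smul_apply, Pi.smul_apply, LinearMap.add_apply, Pi.add_apply, smul_add, hpin]
  refine (norm_add_le _ _).trans ?_
  -- the `a`-part
  have ha : ‖((((((θ.ℓ₆ + 1 : ℕ) : ℝ)) ^ x.k)⁻¹ ^ (θ.d₆ + 1) : ℝ) : ℂ) • aY x.toKIdx (Pi.single v E) u‖ ≤
      θ.b₁ * ‖E‖ * Real.exp (-(δ * unitDistY x u v)) := by
    by_cases huv : u = v
    · subst huv
      rw [unitDistY_self, mul_zero, neg_zero, Real.exp_zero, mul_one]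
      exact norm_etaD_smul_aY_single_le x (by omega) hb₁ u u E
    · rw [aY_single_of_ne _ huv, smul_zero, norm_zero]
      exact mul_nonneg (mul_nonneg hb₁ (norm_nonneg E)) (Real.exp_pos _).le
  -- the `J`-part, from the adjoint current (generic tables)
  have hJpart : ‖((((((θ.ℓ₆ + 1 : ℕ) : ℝ)) ^ x.k)⁻¹ ^ (θ.d₆ + 1) : ℝ) : ℂ) •
        d2JOfY (trDualMatY N) x.toKIdx parS parB Gp Δ2 (𝔡₂ x).form U (Pi.single v E) u‖ ≤
      2 * (N : ℝ) ^ 3 * j₁ * C₂ * Real.exp (δ * r₂) * ‖E‖ * Real.exp (-(δ * unitDistY x u v)) := by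
    rw [norm_smul, Complex.norm_real, Real.norm_of_nonneg hlam]
    exact mul_norm_d2JOfY_single_le_exp_of_adjCurrent x parS parB Gp Δ2 (𝔡₂ x).form U S hlam hj₁ hC₂ hδ hHJ u v E hDsupp hDloc hDsz
  calc ‖((((((θ.ℓ₆ + 1 : ℕ) : ℝ)) ^ x.k)⁻¹ ^ (θ.d₆ + 1) : ℝ) : ℂ) • aY x.toKIdx (Pi.single v E) u‖ +
        ‖((((((θ.ℓ₆ + 1 : ℕ) : ℝ)) ^ x.k)⁻¹ ^ (θ.d₆ + 1) : ℝ) : ℂ) • d2JOfY (trDualMatY N) x.toKIdx parS parB Gp Δ2 (𝔡₂ x).form U (Pi.single v E) u‖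
      ≤ θ.b₁ * ‖E‖ * Real.exp (-(δ * unitDistY x u v)) +
          2 * (N : ℝ) ^ 3 * j₁ * C₂ * Real.exp (δ * r₂) * ‖E‖ * Real.exp (-(δ * unitDistY x u v)) := add_le_add ha hJpart
    _ = (θ.b₁ + 2 * (N : ℝ) ^ 3 * j₁ * C₂ * Real.exp (δ * r₂)) * ‖E‖ * Real.exp (-(δ * unitDistY x u v)) := by ring

/-- ★★ **THE `𝒥`-ROW ON STAR PAIRS UNDER THE PIN, THE DOOR's BINDER ORDER** — (ii-out) asked on STAR pairs only (`inΛstY`), (ii) everywhere; the token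
`((((ℓ+1 : ℕ) : ℝ) ^ x.k)⁻¹) ^ (d+1)` is def-Y's `etaDY x`. [cite: Balaban1985BackgroundPropagators, (3.156) p.428, (3.136) p.422, (3.155) p.427; Balaban1984PropagatorsII, (2.3) p.224; Balaban1985Averaging, (136) p.39] -/
theorem JRowPrint_of_adjCurrent_onΛst_pin (hD : 2 ≤ θ.d₆ + 1) (x : MemberY θ.d₆ θ.ℓ₆ θ.hd' θ.hL' θ.b₀ θ.b₁ Mstar') [DecidableEq (IBondY x.toKIdx)]
    (𝔢 : SectELettersY (Matrix (Fin N) (Fin N) ℂ) x) (parS : SiteParY (Matrix (Fin N) (Fin N) ℂ) x.toKIdx) (parB : BondParY (Matrix (Fin N) (Fin N) ℂ) x.toKIdx)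
    (Gp : SiteOpY (Matrix (Fin N) (Fin N) ℂ) x.toKIdx) (Δ2 : BondOpY (Matrix (Fin N) (Fin N) ℂ) x.toKIdx)
    (U : CfgY (Matrix (Fin N) (Fin N) ℂ) x.toKIdx) (S : IBondY x.toKIdx → Prop) {j₁ C₂ r₂ δ : ℝ} (hj₁ : 0 ≤ j₁) (hC₂ : 0 ≤ C₂) (hδ : 0 ≤ δ)
    (hpin : 𝔢.D2J U = d2JOfY (trDualMatY N) x.toKIdx parS parB Gp Δ2 (𝔡₂ x).form U)
    (hHJ : ∀ z, S z → etaDY x * ‖trAdjY (trDualMatY N) (H1Y x.toKIdx parS parB Gp Δ2 U) (JY x.toKIdx U) z‖ ≤ j₁)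
    (hDsupp : ∀ (u v : IBondY x.toKIdx) (E a : Matrix (Fin N) (Fin N) ℂ) (z : IBondY x.toKIdx), inΛstY x u → inΛstY x v →
      (𝔡₂ x).form U (Pi.single v E) (Pi.single u a) z ≠ 0 → S z)
    (hDloc : ∀ (u v : IBondY x.toKIdx) (E a : Matrix (Fin N) (Fin N) ℂ), r₂ < unitDistY x u v → (𝔡₂ x).form U (Pi.single v E) (Pi.single u a) = 0)
    (hDsz : ∀ (u v : IBondY x.toKIdx) (E a : Matrix (Fin N) (Fin N) ℂ), ∑ z, ‖(𝔡₂ x).form U (Pi.single v E) (Pi.single u a) z‖ ≤ C₂ * ‖E‖ * ‖a‖) :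
    ∀ (u v : IBondY x.toKIdx) (E : Matrix (Fin N) (Fin N) ℂ), inΛstY x u → inΛstY x v →
      ‖((((etaDY x : ℝ) : ℂ) • (aY x.toKIdx + 𝔢.D2J U)).restrictScalars ℝ) (Pi.single v E) u‖ ≤
        (θ.b₁ + 2 * (N : ℝ) ^ 3 * j₁ * C₂ * Real.exp (δ * r₂)) * ‖E‖ * Real.exp (-(δ * unitDistY x u v)) :=
  fun u v E hu hv => JRowPrint_of_adjCurrent_at_pin θ Mstar' 𝔡₂ hD x 𝔢 parS parB Gp Δ2 U S hj₁ hC₂ hδ hpin hHJ u v E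
    (fun a z h => hDsupp u v E a z hu hv h) (hDloc u v E) (hDsz u v E)

end JRowPin

/-! ## §1c  [5]'s reality at PRINT's tables: `⟨D̃⁽²⁾·,J⟩` built on `H₁(U)` fed `G′_phys` is real and trace-symmetric for real `D̃⁽²⁾(U)`, `Δ⁽²⁾(U)` -/

section RealityP

variable {d ℓ : ℕ} {hd : 1 ≤ d + 1} {hL : Odd (ℓ + 1) ∧ 1 < ℓ + 1} {b₀ b₁ : ℝ}

/-- ★ print's site propagator `G′_phys(U) = η²·G′_latt(U)` over the symmetrised transporters is REAL at a unitary background (a real multiple of def-Y's real `GpY`,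
`GpY_parSymY_isRealOpY`). [cite: Balaban1985BackgroundPropagators, (3.24)–(3.25) p.394, p.396 («values in G»)] -/
theorem GpPhysY_parSymY_isRealOpY (i : KIdx d ℓ hd hL b₀ b₁) {U : CfgY (Matrix (Fin N) (Fin N) ℂ) i}
    (hU : ∀ μ x, U μ x ∈ unitaryUnits (Matrix (Fin N) (Fin N) ℂ)) : IsRealOpY (GpPhysY i (parSymY i) U) := by
  intro Λ
  rw [GpPhysY_apply, LinearMap.smul_apply, LinearMap.smul_apply, GpY_parSymY_isRealOpY i hU Λ, star_smul, Complex.star_def, Complex.conj_ofReal]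

variable (θ : Stage3Params) (Mstar' : ℕ) (𝔡₂ : Dt2Y N θ Mstar')

/-- ★★ **[5]'s `⟨D̃⁽²⁾·,J⟩` letter AT PRINT's `H₁(U)` IS REAL** at a unitary-valued `U`, for a real residual `Δ⁽²⁾(U)` and a real `D̃⁽²⁾(U)` — def-Y's
`sectEYWithDt2_D2J_isRealOpY` with `GpY ↦ GpPhysY` (`H1Y_isRealOpY` is generic in the site propagator; `G′_phys` is real by `GpPhysY_parSymY_isRealOpY`).
[cite: Balaban1985BackgroundPropagators, (3.156) p.428, (3.129) p.421, p.396 («values in G»)] -/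
theorem d2JOfY_GpPhysY_isRealOpY_of_real (x : MemberY θ.d₆ θ.ℓ₆ θ.hd' θ.hL' θ.b₀ θ.b₁ Mstar') {U : CfgY (Matrix (Fin N) (Fin N) ℂ) x.toKIdx}
    (hU : ∀ μ y, U μ y ∈ unitaryUnits (Matrix (Fin N) (Fin N) ℂ)) (Δ2 : BondOpY (Matrix (Fin N) (Fin N) ℂ) x.toKIdx) (hΔ2 : IsRealOpY (Δ2 U))
    (hD : ∀ B B' : IBondY x.toKIdx → Matrix (Fin N) (Fin N) ℂ, (𝔡₂ x).form U (star B) (star B') = star ((𝔡₂ x).form U B B')) :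
    IsRealOpY (d2JOfY (trDualMatY N) x.toKIdx (parSymY x.toKIdx) (parBY x.toKIdx) (GpPhysY x.toKIdx (parSymY x.toKIdx)) Δ2 (𝔡₂ x).form U) := by
  have hUu := mem_unitary_of_mem_unitaryUnits x.toKIdx hU
  have hS := parSymY_mem_unitary x.toKIdx hU
  have hB := parBY_mem_unitary x.toKIdx hU
  have hGp := GpPhysY_parSymY_isRealOpY x.toKIdx hU
  have hH1 := H1Y_isRealOpY x.toKIdx U hUu _ _ _ hS hB hGp _ hΔ2
  exact fun B => d2JOfY_star_of_unitary x.toKIdx (trDualMatY N) _ _ _ _ _ trDualMatY_τ_star (star_eq_inv_of_mem_unitaryUnits x.toKIdx hU) hD hH1 B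

/-- ★★ **… AND TRACE-SYMMETRIC (`IsSymmTr 1`)** — the door's reality row for a Sect.-E letter pinned to [5]'s form at print's `H₁(U)`, from the letter properties of
`D̃⁽²⁾(U)` (real; symmetric by `(𝔡₂ x).symm`) and `Δ⁽²⁾(U)` (real) alone (def-Y's `isSymmTr_of_trSymm_of_real` + `trPairY_d2JOfY_symm'`).
[cite: Balaban1985BackgroundPropagators, (3.156) p.428, Thm 3.11 p.416 («symmetric»)] -/
theorem d2JOfY_GpPhysY_isSymmTr_of_real (x : MemberY θ.d₆ θ.ℓ₆ θ.hd' θ.hL' θ.b₀ θ.b₁ Mstar') {U : CfgY (Matrix (Fin N) (Fin N) ℂ) x.toKIdx}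
    (hU : ∀ μ y, U μ y ∈ unitaryUnits (Matrix (Fin N) (Fin N) ℂ)) (Δ2 : BondOpY (Matrix (Fin N) (Fin N) ℂ) x.toKIdx) (hΔ2 : IsRealOpY (Δ2 U))
    (hD : ∀ B B' : IBondY x.toKIdx → Matrix (Fin N) (Fin N) ℂ, (𝔡₂ x).form U (star B) (star B') = star ((𝔡₂ x).form U B B')) :
    IsSymmTr (fun _ => (1 : ℝ)) (d2JOfY (trDualMatY N) x.toKIdx (parSymY x.toKIdx) (parBY x.toKIdx) (GpPhysY x.toKIdx (parSymY x.toKIdx)) Δ2 (𝔡₂ x).form U) :=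
  isSymmTr_of_trSymm_of_real _
    (fun Φ Ψ => trPairY_d2JOfY_symm' (trDualMatY N) x.toKIdx (parSymY x.toKIdx) (parBY x.toKIdx) (GpPhysY x.toKIdx (parSymY x.toKIdx)) Δ2
      (𝔡₂ x).form (𝔡₂ x).symm U Φ Ψ)
    (d2JOfY_GpPhysY_isRealOpY_of_real θ Mstar' 𝔡₂ x hU Δ2 hΔ2 hD)

end RealityP

/-! ## §2  The star doors of record at the v4P letters with BOTH node-N06-side rows BY NAME at print's objects -/

section Doors

/-- ★★★ **THE STAR DOOR OF RECORD AT THE v4P LETTERS WITH THE P-ROW AND THE 𝒥-ROW BY NAME AT PRINT's OBJECTS, PIVOT-LINE REGIME** — `…RecordV4PPivotLines` §2's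
`…_of_ineq3132_of_pivotLines_onΛst_on_unit` (p708611) with the displayed 𝒥-row on STAR pairs REPLACED by §1 at print's tables: the PIN
`(𝔢₀ x).D2J U = d2JOfY (trDualMatY N) … (parSymY) (parBY) (GpPhysY (parSymY)) (𝔯 x).Δ2 (𝔡₂ x).form U`, (b†) the print-unit sup of the adjoint current of PRINT's
`H₁(U) = H1Y … (GpPhysY …) (𝔯 x).Δ2 U` on a support predicate `S` (node N06's (3.136) content), (c-out) on STAR pairs, (c) locality∕size of `D̃⁽²⁾`; `K_J := θ.b₁ + 2N³j₁C₂e^{δr₂}`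
(`KJadj_nonneg`).  Other displayed rows as there: `G ≤ U(N)`, `G`-valued `U`, the averaged field `δ_V`-small on the pivot lines of the bad-source star corners (`ℓ·2δ_V < 1`),
[5]'s reality `IsSymmTr ((𝔯 x).Δ2 U)` ∕ `IsSymmTr ((𝔢₀ x).D2J U)`, node N06's row 26 `B9.Ineq3132 (d+1) ((opsYNuStOfRecordV4PE N θ M⋆ 𝔯 𝔢st 𝔴 𝔈 x).QG1Qinv) B_P δ U`, the Δ_k-row `γ₀`.
[cite: Balaban1985BackgroundPropagators, (3.132) p.422, (3.136) p.422, Thm 3.12 p.423, (3.35) p.396, (3.155)–(3.158) pp.427–428, (3.129) p.421; Balaban1984PropagatorsII, (2.149) p.249,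
(2.3) p.224, Lemma 2.4 p.245; Balaban1985Averaging, (125)–(126) p.36, (136) p.39; Balaban1985UV3, (24) p.262, pp.271–272; Balaban1982Higgs1, (3.24) p.616; BenfattoEtAl1978,
Lemma (4.5)–(4.7) p.152 (class form; bent window, presentation and coordinates ours)] -/
theorem eq324_CsDeltaCPstY_lettersYOfRecordV4P_sectEStYOfRecordV7_trBasis_of_ineq3132_of_adjCurrentP_of_pivotLines_onΛst_on_unit (N : ℕ) [NeZero N]
    (θ : Stage3Params) (hD : 2 ≤ θ.d₆ + 1) (Mstar : ℕ) (𝔡₂ : Dt2Y N θ Mstar)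
    (𝔯 : ResY N θ Mstar) (𝔢₀ : SectEY N θ Mstar) (𝔢st : SectEStY N θ Mstar) (𝔴 : RWEY N θ Mstar) (𝔈 : ExpsY N θ Mstar) {γ₀ BP δ δV j₁ C₂ r₂ : ℝ} (hγ₀ : 0 < γ₀) (hBP : 0 ≤ BP)
    (hδ : 0 < δ) (hδV : 0 ≤ δV) (hj₁ : 0 ≤ j₁) (hC₂ : 0 ≤ C₂)
    (hsmall : (θ.ℓ₆ : ℝ) * (2 * δV) < 1)
    (t D : ℕ) {ϰ : ℝ} (hϰ : 0 < ϰ) {p₀ σ' c κ' : ℝ} (hp₀ : 2 / 3 < p₀) (hσ : 0 < σ') (hc : 0 ≤ c) (hκ : 0 < κ') (hκσ : κ' < σ' * (t + 1)) :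
    ∃ b₁ : ℝ, ∀ b₀ : ℝ, b₁ < b₀ → ∃ C : ℝ, 0 ≤ C ∧ ∀ η : ℝ, 0 < η → η ≤ 1 →
      ∀ (x : MemberY θ.d₆ θ.ℓ₆ θ.hd' θ.hL' θ.b₀ θ.b₁ Mstar) [DecidableEq (IBondY x.toKIdx)]
        {G : Subgroup (Matrix (Fin N) (Fin N) ℂ)ˣ}, G ≤ unitaryUnits (Matrix (Fin N) (Fin N) ℂ) →
      ∀ (U : CfgY (Matrix (Fin N) (Fin N) ℂ) x.toKIdx), (∀ μ z, U μ z ∈ G) →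
        (∀ c' : CBondStY x, ¬ GoodY x c'.1.1 → ∀ i : ℕ, i < θ.ℓ₆ →
          ‖((avYOfRecord x U ⟨ofZ x (labK x c'.1.1 + (i : ℤ) • unitVec c'.1.2), c'.1.2⟩ : (Matrix (Fin N) (Fin N) ℂ)ˣ) :
              Matrix (Fin N) (Fin N) ℂ) - 1‖ ≤ δV) →
        IsSymmTr (fun _ => (1 : ℝ)) ((𝔯 x).Δ2 U) → IsSymmTr (fun _ => (1 : ℝ)) ((𝔢₀ x).D2J U) →
      ∀ {σ : Type} [Fintype σ] [DecidableEq σ] [Nonempty σ] (ι : σ → IBondY x.toKIdx), Function.Injective ι → (∀ s, lamTstY x (ι s)) →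
        B9.Ineq3132 (θ.d₆ + 1) (opsYNuStOfRecordV4PE N θ Mstar 𝔯 𝔢st 𝔴 𝔈 x).QG1Qinv BP δ U →
        (𝔢₀ x).D2J U = d2JOfY (trDualMatY N) x.toKIdx (parSymY x.toKIdx) (parBY x.toKIdx) (GpPhysY x.toKIdx (parSymY x.toKIdx)) (𝔯 x).Δ2
          (𝔡₂ x).form U →
      ∀ (S : IBondY x.toKIdx → Prop),
        (∀ z, S z → etaDY x * ‖trAdjY (trDualMatY N)
          (H1Y x.toKIdx (parSymY x.toKIdx) (parBY x.toKIdx) (GpPhysY x.toKIdx (parSymY x.toKIdx)) (𝔯 x).Δ2 U) (JY x.toKIdx U) z‖ ≤ j₁) →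
        (∀ (u v : IBondY x.toKIdx) (E a : Matrix (Fin N) (Fin N) ℂ) (z : IBondY x.toKIdx), inΛstY x u → inΛstY x v →
          (𝔡₂ x).form U (Pi.single v E) (Pi.single u a) z ≠ 0 → S z) →
        (∀ (u v : IBondY x.toKIdx) (E a : Matrix (Fin N) (Fin N) ℂ), r₂ < unitDistY x u v → (𝔡₂ x).form U (Pi.single v E) (Pi.single u a) = 0) →
        (∀ (u v : IBondY x.toKIdx) (E a : Matrix (Fin N) (Fin N) ℂ), ∑ z, ‖(𝔡₂ x).form U (Pi.single v E) (Pi.single u a) z‖ ≤ C₂ * ‖E‖ * ‖a‖) →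
        (∀ B : IBondY x.toKIdx → Matrix (Fin N) (Fin N) ℂ, (∀ q, ¬ inΛstY x q → B q = 0) → (∀ q, IsAxialY x q → B q = 0) →
          (∀ c' : CBondStY x, Q1Y x (avYOfRecord x) U c'.1 B = 0) →
          γ₀ * trIP (fun _ => (1 : ℝ)) B B ≤
            trIP (fun _ => (1 : ℝ)) B (deltaKPstY x (lettersYOfRecordV4P N θ Mstar 𝔯 x) (sectEStYOfRecordV7 N θ Mstar 𝔢₀ x) U B)) →
      ∃ (Λ : Finset (B1Eq324BenfattoLemma.Site (θ.d₆ + 1 + (θ.d₆ + 1) + 1))) (e' : σ × TrIdx N ≃ ↥Λ),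
        ((gaussianFieldOfKernel fun u w => if h : u ∈ Λ ∧ w ∈ Λ then
            ((Matrix.reindex e' e'
              (Matrix.of fun p q : σ × TrIdx N =>
                  trReForm (trBasis N p.2) (((CsDeltaCPstY x (lettersYOfRecordV4P N θ Mstar 𝔯 x)
            (sectEStYOfRecordV7 N θ Mstar 𝔢₀ x) U).restrictScalars ℝ)
                    (Pi.single (ι q.1) (trBasis N q.2)) (ι p.1))))⁻¹ :
                Matrix ↥Λ ↥Λ ℝ) ⟨u, h.1⟩ ⟨w, h.2⟩ else 0).map
            (fun (z : B1Eq324BenfattoLemma.Site (θ.d₆ + 1 + (θ.d₆ + 1) + 1) → ℝ) (q : σ × TrIdx N) => z ((e' q : ↥Λ) : B1Eq324BenfattoLemma.Site (θ.d₆ + 1 + (θ.d₆ + 1) + 1))) =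
          gaussianFieldOfKernel fun p q =>
            ((Matrix.of fun p q : σ × TrIdx N =>
                trReForm (trBasis N p.2) (((CsDeltaCPstY x (lettersYOfRecordV4P N θ Mstar 𝔯 x)
            (sectEStYOfRecordV7 N θ Mstar 𝔢₀ x) U).restrictScalars ℝ)
                  (Pi.single (ι q.1) (trBasis N q.2)) (ι p.1)))⁻¹ :
              Matrix (σ × TrIdx N) (σ × TrIdx N) ℝ) p q) ∧
        (∀ p : ℝ, 0 ≤ p →
          ((fun (z : B1Eq324BenfattoLemma.Site (θ.d₆ + 1 + (θ.d₆ + 1) + 1) → ℝ) (q : σ × TrIdx N) => z ((e' q : ↥Λ) : B1Eq324BenfattoLemma.Site (θ.d₆ + 1 + (θ.d₆ + 1) + 1))) ⁻¹'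
              {ω : σ × TrIdx N → ℝ | ∀ q, |ω q| ≤ p}) =ᵐ[gaussianFieldOfKernel fun u w => if h : u ∈ Λ ∧ w ∈ Λ then
                ((Matrix.reindex e' e'
                  (Matrix.of fun p q : σ × TrIdx N =>
                      trReForm (trBasis N p.2) (((CsDeltaCPstY x (lettersYOfRecordV4P N θ Mstar 𝔯 x)
            (sectEStYOfRecordV7 N θ Mstar 𝔢₀ x) U).restrictScalars ℝ)
                        (Pi.single (ι q.1) (trBasis N q.2)) (ι p.1))))⁻¹ :
                    Matrix ↥Λ ↥Λ ℝ) ⟨u, h.1⟩ ⟨w, h.2⟩ else 0]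
            smallFieldSet Λ p) ∧
        ∀ (s : ℕ) (I J : Finset (B1Eq324BenfattoLemma.Site (θ.d₆ + 1 + (θ.d₆ + 1) + 1))) (𝔞 : Coef (θ.d₆ + 1 + (θ.d₆ + 1) + 1)),
          I.Nonempty → J ⊆ I → J ⊆ Λ → coefSup s D 𝔞 J ≤ c * η ^ σ' →
          0 < ∫ z, cutoffBoltzmann (hamiltonian s D ϰ 𝔞 J) I (B10.pFun b₀ p₀ η) z ∂(gaussianFieldOfKernel fun u w => if h : u ∈ Λ ∧ w ∈ Λ then
              ((Matrix.reindex e' e'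
                (Matrix.of fun p q : σ × TrIdx N =>
                    trReForm (trBasis N p.2) (((CsDeltaCPstY x (lettersYOfRecordV4P N θ Mstar 𝔯 x)
            (sectEStYOfRecordV7 N θ Mstar 𝔢₀ x) U).restrictScalars ℝ)
                      (Pi.single (ι q.1) (trBasis N q.2)) (ι p.1))))⁻¹ :
                  Matrix ↥Λ ↥Λ ℝ) ⟨u, h.1⟩ ⟨w, h.2⟩ else 0) ∧
            |Real.log (∫ z, cutoffBoltzmann (hamiltonian s D ϰ 𝔞 J) I (B10.pFun b₀ p₀ η) z ∂(gaussianFieldOfKernel fun u w =>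
                if h : u ∈ Λ ∧ w ∈ Λ then
                  ((Matrix.reindex e' e'
                    (Matrix.of fun p q : σ × TrIdx N =>
                        trReForm (trBasis N p.2) (((CsDeltaCPstY x (lettersYOfRecordV4P N θ Mstar 𝔯 x)
            (sectEStYOfRecordV7 N θ Mstar 𝔢₀ x) U).restrictScalars ℝ)
                          (Pi.single (ι q.1) (trBasis N q.2)) (ι p.1))))⁻¹ :
                      Matrix ↥Λ ↥Λ ℝ) ⟨u, h.1⟩ ⟨w, h.2⟩ else 0)) -
              cumulantSum (gaussianFieldOfKernel fun u w => if h : u ∈ Λ ∧ w ∈ Λ then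
                  ((Matrix.reindex e' e'
                    (Matrix.of fun p q : σ × TrIdx N =>
                        trReForm (trBasis N p.2) (((CsDeltaCPstY x (lettersYOfRecordV4P N θ Mstar 𝔯 x)
            (sectEStYOfRecordV7 N θ Mstar 𝔢₀ x) U).restrictScalars ℝ)
                          (Pi.single (ι q.1) (trBasis N q.2)) (ι p.1))))⁻¹ :
                      Matrix ↥Λ ↥Λ ℝ) ⟨u, h.1⟩ ⟨w, h.2⟩ else 0)
                (hamiltonian s D ϰ 𝔞 J) t| ≤ C * η ^ κ' * I.card := by
  obtain ⟨b₁, hb₁⟩ := eq324_CsDeltaCPstY_lettersYOfRecordV4P_sectEStYOfRecordV7_trBasis_of_ineq3132_of_pivotLines_onΛst_on_unit N θ Mstar 𝔯 𝔢₀ 𝔢st 𝔴 𝔈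
    hγ₀ hBP (KJadj_nonneg (N := N) (r₂ := r₂) (δ := δ) θ hj₁ hC₂) hδ hδV hsmall t D hϰ hp₀ hσ hc hκ hκσ
  refine ⟨b₁, fun b₀ hb₀ => ?_⟩
  obtain ⟨C, hC, hE⟩ := hb₁ b₀ hb₀
  refine ⟨C, hC, ?_⟩
  intro η hη hηle x _ G hG U hU hV hΔ2 hD2J σ _ _ _ ι hι hιT h3132 hpin S hHJ hDsupp hDloc hDsz hco
  exact hE η hη hηle x hG U hU hV hΔ2 hD2J ι hι hιT h3132
    (JRowPrint_of_adjCurrent_onΛst_pin θ Mstar 𝔡₂ hD x (𝔢₀ x) (parSymY x.toKIdx) (parBY x.toKIdx) (GpPhysY x.toKIdx (parSymY x.toKIdx)) (𝔯 x).Δ2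
      U S hj₁ hC₂ hδ.le hpin hHJ hDsupp hDloc hDsz) hco

/-- ★★★ **FAMILY FORM AT PRINT's CLASS `bg9YP`** — §2 under the (3.132) CLAIM `B9.Stmt3132Printed (d+1) c35 geo9Y (bg9YP SU(N)) (siteKernelP ∘ ….QGQinv) (siteKernelP ∘ ….QG1Qinv)`
for def-Y's STAR v4P record (the field `s3132` of `B9LeafX (Y9OfRecordP …)` at `c35 := c35Y`); print's thresholds `M₄`, `a₀`, ONE rate `δ`; `U` is `SU(N)`-valued by
`mem_of_reg335P`. [cite: Balaban1985BackgroundPropagators, (3.132) p.422, (3.136) p.422, Thm 3.12 p.423, (3.35)–(3.36) p.396, (3.155)–(3.158) pp.427–428; Balaban1984PropagatorsII,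
(2.149) p.249, (2.3) p.224, Lemma 2.4 p.245; Balaban1985Averaging, (125)–(126) p.36, (136) p.39; Balaban1985UV3, (24) p.262; Balaban1982Higgs1, (3.24) p.616; BenfattoEtAl1978,
Lemma (4.5)–(4.7) p.152 (class form; bent window, presentation and coordinates ours)] -/
theorem eq324_CsDeltaCPstY_lettersYOfRecordV4P_sectEStYOfRecordV7_trBasis_of_stmt3132Printed_P_of_adjCurrentP_of_pivotLines_onΛst_on_unit (N : ℕ) [NeZero N]
    (θ : Stage3Params) (hD : 2 ≤ θ.d₆ + 1) (Mstar : ℕ) (𝔡₂ : Dt2Y N θ Mstar)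
    (𝔯 : ResY N θ Mstar) (𝔢₀ : SectEY N θ Mstar) (𝔢st : SectEStY N θ Mstar) (𝔴 : RWEY N θ Mstar) (𝔈 : ExpsY N θ Mstar) {c35 : ℝ}
    (h26 : B9.Stmt3132Printed (θ.d₆ + 1) c35
      (geo9Y (d := θ.d₆) (ℓ := θ.ℓ₆) (hd := θ.hd') (hL := θ.hL') (b₀ := θ.b₀) (b₁ := θ.b₁) (Mstar := Mstar))
      (bg9YP (Matrix (Fin N) (Fin N) ℂ) (specialUnitaryUnits (Fin N)))
      (fun x => siteKernelP (opsYNuStOfRecordV4PE N θ Mstar 𝔯 𝔢st 𝔴 𝔈 x).QGQinv)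
      (fun x => siteKernelP (opsYNuStOfRecordV4PE N θ Mstar 𝔯 𝔢st 𝔴 𝔈 x).QG1Qinv))
    {γ₀ δV j₁ C₂ r₂ : ℝ} (hγ₀ : 0 < γ₀) (hδV : 0 ≤ δV) (hj₁ : 0 ≤ j₁) (hC₂ : 0 ≤ C₂)
    (hsmall : (θ.ℓ₆ : ℝ) * (2 * δV) < 1)
    (t D : ℕ) {ϰ : ℝ} (hϰ : 0 < ϰ) {p₀ σ' c κ' : ℝ} (hp₀ : 2 / 3 < p₀) (hσ : 0 < σ') (hc : 0 ≤ c) (hκ : 0 < κ') (hκσ : κ' < σ' * (t + 1)) :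
    ∃ M₄ δ a₀ : ℝ, 0 < M₄ ∧ 0 < δ ∧ 0 < a₀ ∧ ∃ b₁ : ℝ, ∀ b₀ : ℝ, b₁ < b₀ → ∃ C : ℝ, 0 ≤ C ∧ ∀ η : ℝ, 0 < η → η ≤ 1 →
      ∀ (x : MemberY θ.d₆ θ.ℓ₆ θ.hd' θ.hL' θ.b₀ θ.b₁ Mstar) [DecidableEq (IBondY x.toKIdx)], M₄ ≤ (geo9Y x).M →
      ∀ α₀ : ℝ, 0 < α₀ → (geo9Y x).M * α₀ ≤ a₀ →
      ∀ (U : CfgY (Matrix (Fin N) (Fin N) ℂ) x.toKIdx),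
        (bg9YP (Matrix (Fin N) (Fin N) ℂ) (specialUnitaryUnits (Fin N)) x).Reg335 c35 α₀ U →
        (bg9YP (Matrix (Fin N) (Fin N) ℂ) (specialUnitaryUnits (Fin N)) x).Reg336 c35 α₀ U →
        (∀ c' : CBondStY x, ¬ GoodY x c'.1.1 → ∀ i : ℕ, i < θ.ℓ₆ →
          ‖((avYOfRecord x U ⟨ofZ x (labK x c'.1.1 + (i : ℤ) • unitVec c'.1.2), c'.1.2⟩ : (Matrix (Fin N) (Fin N) ℂ)ˣ) :
              Matrix (Fin N) (Fin N) ℂ) - 1‖ ≤ δV) →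
        IsSymmTr (fun _ => (1 : ℝ)) ((𝔯 x).Δ2 U) → IsSymmTr (fun _ => (1 : ℝ)) ((𝔢₀ x).D2J U) →
      ∀ {σ : Type} [Fintype σ] [DecidableEq σ] [Nonempty σ] (ι : σ → IBondY x.toKIdx), Function.Injective ι → (∀ s, lamTstY x (ι s)) →
        (𝔢₀ x).D2J U = d2JOfY (trDualMatY N) x.toKIdx (parSymY x.toKIdx) (parBY x.toKIdx) (GpPhysY x.toKIdx (parSymY x.toKIdx)) (𝔯 x).Δ2
          (𝔡₂ x).form U →
      ∀ (S : IBondY x.toKIdx → Prop),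
        (∀ z, S z → etaDY x * ‖trAdjY (trDualMatY N)
          (H1Y x.toKIdx (parSymY x.toKIdx) (parBY x.toKIdx) (GpPhysY x.toKIdx (parSymY x.toKIdx)) (𝔯 x).Δ2 U) (JY x.toKIdx U) z‖ ≤ j₁) →
        (∀ (u v : IBondY x.toKIdx) (E a : Matrix (Fin N) (Fin N) ℂ) (z : IBondY x.toKIdx), inΛstY x u → inΛstY x v →
          (𝔡₂ x).form U (Pi.single v E) (Pi.single u a) z ≠ 0 → S z) →
        (∀ (u v : IBondY x.toKIdx) (E a : Matrix (Fin N) (Fin N) ℂ), r₂ < unitDistY x u v → (𝔡₂ x).form U (Pi.single v E) (Pi.single u a) = 0) →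
        (∀ (u v : IBondY x.toKIdx) (E a : Matrix (Fin N) (Fin N) ℂ), ∑ z, ‖(𝔡₂ x).form U (Pi.single v E) (Pi.single u a) z‖ ≤ C₂ * ‖E‖ * ‖a‖) →
        (∀ B : IBondY x.toKIdx → Matrix (Fin N) (Fin N) ℂ, (∀ q, ¬ inΛstY x q → B q = 0) → (∀ q, IsAxialY x q → B q = 0) →
          (∀ c' : CBondStY x, Q1Y x (avYOfRecord x) U c'.1 B = 0) →
          γ₀ * trIP (fun _ => (1 : ℝ)) B B ≤
            trIP (fun _ => (1 : ℝ)) B (deltaKPstY x (lettersYOfRecordV4P N θ Mstar 𝔯 x) (sectEStYOfRecordV7 N θ Mstar 𝔢₀ x) U B)) →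
      ∃ (Λ : Finset (B1Eq324BenfattoLemma.Site (θ.d₆ + 1 + (θ.d₆ + 1) + 1))) (e' : σ × TrIdx N ≃ ↥Λ),
        ((gaussianFieldOfKernel fun u w => if h : u ∈ Λ ∧ w ∈ Λ then
            ((Matrix.reindex e' e'
              (Matrix.of fun p q : σ × TrIdx N =>
                  trReForm (trBasis N p.2) (((CsDeltaCPstY x (lettersYOfRecordV4P N θ Mstar 𝔯 x)
            (sectEStYOfRecordV7 N θ Mstar 𝔢₀ x) U).restrictScalars ℝ)
                    (Pi.single (ι q.1) (trBasis N q.2)) (ι p.1))))⁻¹ :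
                Matrix ↥Λ ↥Λ ℝ) ⟨u, h.1⟩ ⟨w, h.2⟩ else 0).map
            (fun (z : B1Eq324BenfattoLemma.Site (θ.d₆ + 1 + (θ.d₆ + 1) + 1) → ℝ) (q : σ × TrIdx N) => z ((e' q : ↥Λ) : B1Eq324BenfattoLemma.Site (θ.d₆ + 1 + (θ.d₆ + 1) + 1))) =
          gaussianFieldOfKernel fun p q =>
            ((Matrix.of fun p q : σ × TrIdx N =>
                trReForm (trBasis N p.2) (((CsDeltaCPstY x (lettersYOfRecordV4P N θ Mstar 𝔯 x)
            (sectEStYOfRecordV7 N θ Mstar 𝔢₀ x) U).restrictScalars ℝ)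
                  (Pi.single (ι q.1) (trBasis N q.2)) (ι p.1)))⁻¹ :
              Matrix (σ × TrIdx N) (σ × TrIdx N) ℝ) p q) ∧
        (∀ p : ℝ, 0 ≤ p →
          ((fun (z : B1Eq324BenfattoLemma.Site (θ.d₆ + 1 + (θ.d₆ + 1) + 1) → ℝ) (q : σ × TrIdx N) => z ((e' q : ↥Λ) : B1Eq324BenfattoLemma.Site (θ.d₆ + 1 + (θ.d₆ + 1) + 1))) ⁻¹'
              {ω : σ × TrIdx N → ℝ | ∀ q, |ω q| ≤ p}) =ᵐ[gaussianFieldOfKernel fun u w => if h : u ∈ Λ ∧ w ∈ Λ then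
                ((Matrix.reindex e' e'
                  (Matrix.of fun p q : σ × TrIdx N =>
                      trReForm (trBasis N p.2) (((CsDeltaCPstY x (lettersYOfRecordV4P N θ Mstar 𝔯 x)
            (sectEStYOfRecordV7 N θ Mstar 𝔢₀ x) U).restrictScalars ℝ)
                        (Pi.single (ι q.1) (trBasis N q.2)) (ι p.1))))⁻¹ :
                    Matrix ↥Λ ↥Λ ℝ) ⟨u, h.1⟩ ⟨w, h.2⟩ else 0]
            smallFieldSet Λ p) ∧
        ∀ (s : ℕ) (I J : Finset (B1Eq324BenfattoLemma.Site (θ.d₆ + 1 + (θ.d₆ + 1) + 1))) (𝔞 : Coef (θ.d₆ + 1 + (θ.d₆ + 1) + 1)),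
          I.Nonempty → J ⊆ I → J ⊆ Λ → coefSup s D 𝔞 J ≤ c * η ^ σ' →
          0 < ∫ z, cutoffBoltzmann (hamiltonian s D ϰ 𝔞 J) I (B10.pFun b₀ p₀ η) z ∂(gaussianFieldOfKernel fun u w => if h : u ∈ Λ ∧ w ∈ Λ then
              ((Matrix.reindex e' e'
                (Matrix.of fun p q : σ × TrIdx N =>
                    trReForm (trBasis N p.2) (((CsDeltaCPstY x (lettersYOfRecordV4P N θ Mstar 𝔯 x)
            (sectEStYOfRecordV7 N θ Mstar 𝔢₀ x) U).restrictScalars ℝ)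
                      (Pi.single (ι q.1) (trBasis N q.2)) (ι p.1))))⁻¹ :
                  Matrix ↥Λ ↥Λ ℝ) ⟨u, h.1⟩ ⟨w, h.2⟩ else 0) ∧
            |Real.log (∫ z, cutoffBoltzmann (hamiltonian s D ϰ 𝔞 J) I (B10.pFun b₀ p₀ η) z ∂(gaussianFieldOfKernel fun u w =>
                if h : u ∈ Λ ∧ w ∈ Λ then
                  ((Matrix.reindex e' e'
                    (Matrix.of fun p q : σ × TrIdx N =>
                        trReForm (trBasis N p.2) (((CsDeltaCPstY x (lettersYOfRecordV4P N θ Mstar 𝔯 x)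
            (sectEStYOfRecordV7 N θ Mstar 𝔢₀ x) U).restrictScalars ℝ)
                          (Pi.single (ι q.1) (trBasis N q.2)) (ι p.1))))⁻¹ :
                      Matrix ↥Λ ↥Λ ℝ) ⟨u, h.1⟩ ⟨w, h.2⟩ else 0)) -
              cumulantSum (gaussianFieldOfKernel fun u w => if h : u ∈ Λ ∧ w ∈ Λ then
                  ((Matrix.reindex e' e'
                    (Matrix.of fun p q : σ × TrIdx N =>
                        trReForm (trBasis N p.2) (((CsDeltaCPstY x (lettersYOfRecordV4P N θ Mstar 𝔯 x)
            (sectEStYOfRecordV7 N θ Mstar 𝔢₀ x) U).restrictScalars ℝ)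
                          (Pi.single (ι q.1) (trBasis N q.2)) (ι p.1))))⁻¹ :
                      Matrix ↥Λ ↥Λ ℝ) ⟨u, h.1⟩ ⟨w, h.2⟩ else 0)
                (hamiltonian s D ϰ 𝔞 J) t| ≤ C * η ^ κ' * I.card := by
  obtain ⟨M₄, δ, a₀, BP, hM₄, hδ, ha₀, hBP, H⟩ := h26
  obtain ⟨b₁, hb₁⟩ := eq324_CsDeltaCPstY_lettersYOfRecordV4P_sectEStYOfRecordV7_trBasis_of_ineq3132_of_adjCurrentP_of_pivotLines_onΛst_on_unit N θ hD Mstar 𝔡₂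
    𝔯 𝔢₀ 𝔢st 𝔴 𝔈 (r₂ := r₂) hγ₀ hBP.le hδ hδV hj₁ hC₂ hsmall t D hϰ hp₀ hσ hc hκ hκσ
  refine ⟨M₄, δ, a₀, hM₄, hδ, ha₀, b₁, fun b₀ hb₀ => ?_⟩
  obtain ⟨C, hC, hE⟩ := hb₁ b₀ hb₀
  refine ⟨C, hC, ?_⟩
  intro η hη hηle x _ hMx α₀ hα₀ hMa U h335 h336 hV hΔ2 hD2J σ _ _ _ ι hι hιT hpin S hHJ hDsupp hDloc hDsz hco
  exact hE η hη hηle x specialUnitaryUnits_le_unitaryUnits U (B9BackgroundsKLevelV1P.mem_of_reg335P x.toKIdx h335.1) hV hΔ2 hD2J ι hι hιT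
    (H x hMx α₀ hα₀ hMa U h335 h336).2 hpin S hHJ hDsupp hDloc hDsz hco

/-- ★★★★ **THE STAR DOOR OF RECORD MODULO NODE N06's SOCKET OF RECORD, BOTH N06-SIDE ROWS AT PRINT's OBJECTS** — from
`h06 : B9LeafX (Y9OfRecordP N θ M⋆ (opsYNuStOfRecordV4PE N θ M⋆ 𝔯 𝔢st 𝔴 𝔈))` (the P-row is `h06.s3132`); displayed per background: the pivot-line smallness of `V` at bad-source
star corners, [5]'s reality, the PIN of `(𝔢₀ x).D2J`, (b†) the adjoint-current sup of print's `H₁(U)` on `S` ((3.136) lives inside the proof of Thm 3.12 and is NOT a field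
of the leaf), (c-out)∕(c) the `D̃⁽²⁾` rows, the Δ_k-row `γ₀` (G-B9-09).
[cite: Balaban1985BackgroundPropagators, (3.132) p.422, (3.136) p.422, Thm 3.12 p.423, (3.35)–(3.36) p.396, (3.155)–(3.158) pp.427–428, Thms 3.1–3.15 pp.397–432 (the leaf);
Balaban1984PropagatorsII, (2.149) p.249, (2.3) p.224, Lemma 2.4 p.245; Balaban1985Averaging, (125)–(126) p.36, (136) p.39; Balaban1985UV3, (24) p.262, pp.271–272;
Balaban1982Higgs1, (3.24) p.616; BenfattoEtAl1978, Lemma (4.5)–(4.7) p.152 (class form; bent window, presentation and coordinates ours)] -/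
theorem eq324_CsDeltaCPstY_lettersYOfRecordV4P_sectEStYOfRecordV7_trBasis_of_b9LeafX_of_adjCurrentP_of_pivotLines_onΛst_on_unit (N : ℕ) [NeZero N]
    (θ : Stage3Params) (hD : 2 ≤ θ.d₆ + 1) (Mstar : ℕ) (𝔡₂ : Dt2Y N θ Mstar)
    (𝔯 : ResY N θ Mstar) (𝔢₀ : SectEY N θ Mstar) (𝔢st : SectEStY N θ Mstar) (𝔴 : RWEY N θ Mstar) (𝔈 : ExpsY N θ Mstar) 
    (h06 : B9LeafX (Y9OfRecordP N θ Mstar (opsYNuStOfRecordV4PE N θ Mstar 𝔯 𝔢st 𝔴 𝔈)))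
    {γ₀ δV j₁ C₂ r₂ : ℝ} (hγ₀ : 0 < γ₀) (hδV : 0 ≤ δV) (hj₁ : 0 ≤ j₁) (hC₂ : 0 ≤ C₂)
    (hsmall : (θ.ℓ₆ : ℝ) * (2 * δV) < 1)
    (t D : ℕ) {ϰ : ℝ} (hϰ : 0 < ϰ) {p₀ σ' c κ' : ℝ} (hp₀ : 2 / 3 < p₀) (hσ : 0 < σ') (hc : 0 ≤ c) (hκ : 0 < κ') (hκσ : κ' < σ' * (t + 1)) :
    ∃ M₄ δ a₀ : ℝ, 0 < M₄ ∧ 0 < δ ∧ 0 < a₀ ∧ ∃ b₁ : ℝ, ∀ b₀ : ℝ, b₁ < b₀ → ∃ C : ℝ, 0 ≤ C ∧ ∀ η : ℝ, 0 < η → η ≤ 1 →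
      ∀ (x : MemberY θ.d₆ θ.ℓ₆ θ.hd' θ.hL' θ.b₀ θ.b₁ Mstar) [DecidableEq (IBondY x.toKIdx)], M₄ ≤ (geo9Y x).M →
      ∀ α₀ : ℝ, 0 < α₀ → (geo9Y x).M * α₀ ≤ a₀ →
      ∀ (U : CfgY (Matrix (Fin N) (Fin N) ℂ) x.toKIdx),
        (bg9YP (Matrix (Fin N) (Fin N) ℂ) (specialUnitaryUnits (Fin N)) x).Reg335 B9PinGeometryKLevelV1.c35Y α₀ U →
        (bg9YP (Matrix (Fin N) (Fin N) ℂ) (specialUnitaryUnits (Fin N)) x).Reg336 B9PinGeometryKLevelV1.c35Y α₀ U →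
        (∀ c' : CBondStY x, ¬ GoodY x c'.1.1 → ∀ i : ℕ, i < θ.ℓ₆ →
          ‖((avYOfRecord x U ⟨ofZ x (labK x c'.1.1 + (i : ℤ) • unitVec c'.1.2), c'.1.2⟩ : (Matrix (Fin N) (Fin N) ℂ)ˣ) :
              Matrix (Fin N) (Fin N) ℂ) - 1‖ ≤ δV) →
        IsSymmTr (fun _ => (1 : ℝ)) ((𝔯 x).Δ2 U) → IsSymmTr (fun _ => (1 : ℝ)) ((𝔢₀ x).D2J U) →
      ∀ {σ : Type} [Fintype σ] [DecidableEq σ] [Nonempty σ] (ι : σ → IBondY x.toKIdx), Function.Injective ι → (∀ s, lamTstY x (ι s)) →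
        (𝔢₀ x).D2J U = d2JOfY (trDualMatY N) x.toKIdx (parSymY x.toKIdx) (parBY x.toKIdx) (GpPhysY x.toKIdx (parSymY x.toKIdx)) (𝔯 x).Δ2
          (𝔡₂ x).form U →
      ∀ (S : IBondY x.toKIdx → Prop),
        (∀ z, S z → etaDY x * ‖trAdjY (trDualMatY N)
          (H1Y x.toKIdx (parSymY x.toKIdx) (parBY x.toKIdx) (GpPhysY x.toKIdx (parSymY x.toKIdx)) (𝔯 x).Δ2 U) (JY x.toKIdx U) z‖ ≤ j₁) →
        (∀ (u v : IBondY x.toKIdx) (E a : Matrix (Fin N) (Fin N) ℂ) (z : IBondY x.toKIdx), inΛstY x u → inΛstY x v →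
          (𝔡₂ x).form U (Pi.single v E) (Pi.single u a) z ≠ 0 → S z) →
        (∀ (u v : IBondY x.toKIdx) (E a : Matrix (Fin N) (Fin N) ℂ), r₂ < unitDistY x u v → (𝔡₂ x).form U (Pi.single v E) (Pi.single u a) = 0) →
        (∀ (u v : IBondY x.toKIdx) (E a : Matrix (Fin N) (Fin N) ℂ), ∑ z, ‖(𝔡₂ x).form U (Pi.single v E) (Pi.single u a) z‖ ≤ C₂ * ‖E‖ * ‖a‖) →
        (∀ B : IBondY x.toKIdx → Matrix (Fin N) (Fin N) ℂ, (∀ q, ¬ inΛstY x q → B q = 0) → (∀ q, IsAxialY x q → B q = 0) →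
          (∀ c' : CBondStY x, Q1Y x (avYOfRecord x) U c'.1 B = 0) →
          γ₀ * trIP (fun _ => (1 : ℝ)) B B ≤
            trIP (fun _ => (1 : ℝ)) B (deltaKPstY x (lettersYOfRecordV4P N θ Mstar 𝔯 x) (sectEStYOfRecordV7 N θ Mstar 𝔢₀ x) U B)) →
      ∃ (Λ : Finset (B1Eq324BenfattoLemma.Site (θ.d₆ + 1 + (θ.d₆ + 1) + 1))) (e' : σ × TrIdx N ≃ ↥Λ),
        ((gaussianFieldOfKernel fun u w => if h : u ∈ Λ ∧ w ∈ Λ then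
            ((Matrix.reindex e' e'
              (Matrix.of fun p q : σ × TrIdx N =>
                  trReForm (trBasis N p.2) (((CsDeltaCPstY x (lettersYOfRecordV4P N θ Mstar 𝔯 x)
            (sectEStYOfRecordV7 N θ Mstar 𝔢₀ x) U).restrictScalars ℝ)
                    (Pi.single (ι q.1) (trBasis N q.2)) (ι p.1))))⁻¹ :
                Matrix ↥Λ ↥Λ ℝ) ⟨u, h.1⟩ ⟨w, h.2⟩ else 0).map
            (fun (z : B1Eq324BenfattoLemma.Site (θ.d₆ + 1 + (θ.d₆ + 1) + 1) → ℝ) (q : σ × TrIdx N) => z ((e' q : ↥Λ) : B1Eq324BenfattoLemma.Site (θ.d₆ + 1 + (θ.d₆ + 1) + 1))) =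
          gaussianFieldOfKernel fun p q =>
            ((Matrix.of fun p q : σ × TrIdx N =>
                trReForm (trBasis N p.2) (((CsDeltaCPstY x (lettersYOfRecordV4P N θ Mstar 𝔯 x)
            (sectEStYOfRecordV7 N θ Mstar 𝔢₀ x) U).restrictScalars ℝ)
                  (Pi.single (ι q.1) (trBasis N q.2)) (ι p.1)))⁻¹ :
              Matrix (σ × TrIdx N) (σ × TrIdx N) ℝ) p q) ∧
        (∀ p : ℝ, 0 ≤ p →
          ((fun (z : B1Eq324BenfattoLemma.Site (θ.d₆ + 1 + (θ.d₆ + 1) + 1) → ℝ) (q : σ × TrIdx N) => z ((e' q : ↥Λ) : B1Eq324BenfattoLemma.Site (θ.d₆ + 1 + (θ.d₆ + 1) + 1))) ⁻¹'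
              {ω : σ × TrIdx N → ℝ | ∀ q, |ω q| ≤ p}) =ᵐ[gaussianFieldOfKernel fun u w => if h : u ∈ Λ ∧ w ∈ Λ then
                ((Matrix.reindex e' e'
                  (Matrix.of fun p q : σ × TrIdx N =>
                      trReForm (trBasis N p.2) (((CsDeltaCPstY x (lettersYOfRecordV4P N θ Mstar 𝔯 x)
            (sectEStYOfRecordV7 N θ Mstar 𝔢₀ x) U).restrictScalars ℝ)
                        (Pi.single (ι q.1) (trBasis N q.2)) (ι p.1))))⁻¹ :
                    Matrix ↥Λ ↥Λ ℝ) ⟨u, h.1⟩ ⟨w, h.2⟩ else 0]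
            smallFieldSet Λ p) ∧
        ∀ (s : ℕ) (I J : Finset (B1Eq324BenfattoLemma.Site (θ.d₆ + 1 + (θ.d₆ + 1) + 1))) (𝔞 : Coef (θ.d₆ + 1 + (θ.d₆ + 1) + 1)),
          I.Nonempty → J ⊆ I → J ⊆ Λ → coefSup s D 𝔞 J ≤ c * η ^ σ' →
          0 < ∫ z, cutoffBoltzmann (hamiltonian s D ϰ 𝔞 J) I (B10.pFun b₀ p₀ η) z ∂(gaussianFieldOfKernel fun u w => if h : u ∈ Λ ∧ w ∈ Λ then
              ((Matrix.reindex e' e'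
                (Matrix.of fun p q : σ × TrIdx N =>
                    trReForm (trBasis N p.2) (((CsDeltaCPstY x (lettersYOfRecordV4P N θ Mstar 𝔯 x)
            (sectEStYOfRecordV7 N θ Mstar 𝔢₀ x) U).restrictScalars ℝ)
                      (Pi.single (ι q.1) (trBasis N q.2)) (ι p.1))))⁻¹ :
                  Matrix ↥Λ ↥Λ ℝ) ⟨u, h.1⟩ ⟨w, h.2⟩ else 0) ∧
            |Real.log (∫ z, cutoffBoltzmann (hamiltonian s D ϰ 𝔞 J) I (B10.pFun b₀ p₀ η) z ∂(gaussianFieldOfKernel fun u w =>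
                if h : u ∈ Λ ∧ w ∈ Λ then
                  ((Matrix.reindex e' e'
                    (Matrix.of fun p q : σ × TrIdx N =>
                        trReForm (trBasis N p.2) (((CsDeltaCPstY x (lettersYOfRecordV4P N θ Mstar 𝔯 x)
            (sectEStYOfRecordV7 N θ Mstar 𝔢₀ x) U).restrictScalars ℝ)
                          (Pi.single (ι q.1) (trBasis N q.2)) (ι p.1))))⁻¹ :
                      Matrix ↥Λ ↥Λ ℝ) ⟨u, h.1⟩ ⟨w, h.2⟩ else 0)) -
              cumulantSum (gaussianFieldOfKernel fun u w => if h : u ∈ Λ ∧ w ∈ Λ then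
                  ((Matrix.reindex e' e'
                    (Matrix.of fun p q : σ × TrIdx N =>
                        trReForm (trBasis N p.2) (((CsDeltaCPstY x (lettersYOfRecordV4P N θ Mstar 𝔯 x)
            (sectEStYOfRecordV7 N θ Mstar 𝔢₀ x) U).restrictScalars ℝ)
                          (Pi.single (ι q.1) (trBasis N q.2)) (ι p.1))))⁻¹ :
                      Matrix ↥Λ ↥Λ ℝ) ⟨u, h.1⟩ ⟨w, h.2⟩ else 0)
                (hamiltonian s D ϰ 𝔞 J) t| ≤ C * η ^ κ' * I.card :=
  eq324_CsDeltaCPstY_lettersYOfRecordV4P_sectEStYOfRecordV7_trBasis_of_stmt3132Printed_P_of_adjCurrentP_of_pivotLines_onΛst_on_unit N θ hD Mstar 𝔡₂ 𝔯 𝔢₀ 𝔢st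
    𝔴 𝔈 h06.s3132 hγ₀ hδV hj₁ hC₂ hsmall t D hϰ hp₀ hσ hc hκ hκσ

end Doors

/-! ## §3  Over `𝔯 := resYOfC2 𝔠` ([5]'s `C⁽²⁾`): the same doors with the two reality rows READ FROM [5]'s LETTER PROPERTIES — p705447 §2–§3's displayed content at print's objects -/

section DoorsC2

/-- ★★★ **THE STAR DOOR OF RECORD AT THE v4P LETTERS OVER `𝔯 := resYOfC2 𝔠`, BOTH N06-SIDE ROWS AT PRINT's OBJECTS, REALITY FROM [5]'s LETTERS** — §2's per-background
door with `IsSymmTr ((𝔯 x).Δ2 U)` := def-Y's `resYOfC2_Δ2_isSymmTr_real` (given `C⁽²⁾(U; A⋆, A′⋆) = C⁽²⁾(U; A, A′)⋆`) and `IsSymmTr ((𝔢₀ x).D2J U)` := §1c under the pin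
(given `D̃⁽²⁾(U; B⋆, B′⋆) = D̃⁽²⁾(U; B, B′)⋆`) — seat n08-d's p705447 §2 `…_of_ineq3132_of_adjCurrent_of_small_onΛst_on_unit` RE-KEYED to print's objects: the record node N06
certifies (`lettersYOfRecordV4P`, row 26 at `opsYNuStOfRecordV4PE … (resYOfC2 𝔠) …`), print's `H₁(U)` in (b†), and the pivot-line regime.
[cite: Balaban1985BackgroundPropagators, (3.132) p.422, (3.134) p.422, (3.136) p.422, Thm 3.11 p.416, Thm 3.12 p.423, (3.35) p.396, (3.155)–(3.158) pp.427–428;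
Balaban1985Averaging, (125)–(126) p.36, (136) p.39; Balaban1984PropagatorsII, (2.149) p.249, (2.3) p.224, Lemma 2.4 p.245; Balaban1985UV3, (24) p.262, pp.271–272;
Balaban1982Higgs1, (3.24) p.616; BenfattoEtAl1978, Lemma (4.5)–(4.7) p.152 (class form; bent window, presentation and coordinates ours)] -/
theorem eq324_CsDeltaCPstY_lettersYOfRecordV4P_sectEStYOfRecordV7_trBasis_of_ineq3132_of_adjCurrentP_of_pivotLines_ofC2_onΛst_on_unit (N : ℕ) [NeZero N]
    (θ : Stage3Params) (hD : 2 ≤ θ.d₆ + 1) (Mstar : ℕ) (𝔠 : C2Y N θ Mstar) (𝔡₂ : Dt2Y N θ Mstar)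
    (𝔢₀ : SectEY N θ Mstar) (𝔢st : SectEStY N θ Mstar) (𝔴 : RWEY N θ Mstar) (𝔈 : ExpsY N θ Mstar) {γ₀ BP δ δV j₁ C₂ r₂ : ℝ} (hγ₀ : 0 < γ₀) (hBP : 0 ≤ BP)
    (hδ : 0 < δ) (hδV : 0 ≤ δV) (hj₁ : 0 ≤ j₁) (hC₂ : 0 ≤ C₂)
    (hsmall : (θ.ℓ₆ : ℝ) * (2 * δV) < 1)
    (t D : ℕ) {ϰ : ℝ} (hϰ : 0 < ϰ) {p₀ σ' c κ' : ℝ} (hp₀ : 2 / 3 < p₀) (hσ : 0 < σ') (hc : 0 ≤ c) (hκ : 0 < κ') (hκσ : κ' < σ' * (t + 1)) :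
    ∃ b₁ : ℝ, ∀ b₀ : ℝ, b₁ < b₀ → ∃ C : ℝ, 0 ≤ C ∧ ∀ η : ℝ, 0 < η → η ≤ 1 →
      ∀ (x : MemberY θ.d₆ θ.ℓ₆ θ.hd' θ.hL' θ.b₀ θ.b₁ Mstar) [DecidableEq (IBondY x.toKIdx)]
        {G : Subgroup (Matrix (Fin N) (Fin N) ℂ)ˣ}, G ≤ unitaryUnits (Matrix (Fin N) (Fin N) ℂ) →
      ∀ (U : CfgY (Matrix (Fin N) (Fin N) ℂ) x.toKIdx), (∀ μ z, U μ z ∈ G) →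
        (∀ c' : CBondStY x, ¬ GoodY x c'.1.1 → ∀ i : ℕ, i < θ.ℓ₆ →
          ‖((avYOfRecord x U ⟨ofZ x (labK x c'.1.1 + (i : ℤ) • unitVec c'.1.2), c'.1.2⟩ : (Matrix (Fin N) (Fin N) ℂ)ˣ) :
              Matrix (Fin N) (Fin N) ℂ) - 1‖ ≤ δV) →
        (∀ A A' : FBondY x.toKIdx → Matrix (Fin N) (Fin N) ℂ, (𝔠 x).form U (star A) (star A') = star ((𝔠 x).form U A A')) →
        (∀ B B' : IBondY x.toKIdx → Matrix (Fin N) (Fin N) ℂ, (𝔡₂ x).form U (star B) (star B') = star ((𝔡₂ x).form U B B')) →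
      ∀ {σ : Type} [Fintype σ] [DecidableEq σ] [Nonempty σ] (ι : σ → IBondY x.toKIdx), Function.Injective ι → (∀ s, lamTstY x (ι s)) →
        B9.Ineq3132 (θ.d₆ + 1) (opsYNuStOfRecordV4PE N θ Mstar (resYOfC2 N θ Mstar 𝔠) 𝔢st 𝔴 𝔈 x).QG1Qinv BP δ U →
        (𝔢₀ x).D2J U = d2JOfY (trDualMatY N) x.toKIdx (parSymY x.toKIdx) (parBY x.toKIdx) (GpPhysY x.toKIdx (parSymY x.toKIdx)) (resYOfC2 N θ Mstar 𝔠 x).Δ2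
          (𝔡₂ x).form U →
      ∀ (S : IBondY x.toKIdx → Prop),
        (∀ z, S z → etaDY x * ‖trAdjY (trDualMatY N)
          (H1Y x.toKIdx (parSymY x.toKIdx) (parBY x.toKIdx) (GpPhysY x.toKIdx (parSymY x.toKIdx)) (resYOfC2 N θ Mstar 𝔠 x).Δ2 U) (JY x.toKIdx U) z‖ ≤ j₁) →
        (∀ (u v : IBondY x.toKIdx) (E a : Matrix (Fin N) (Fin N) ℂ) (z : IBondY x.toKIdx), inΛstY x u → inΛstY x v →
          (𝔡₂ x).form U (Pi.single v E) (Pi.single u a) z ≠ 0 → S z) →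
        (∀ (u v : IBondY x.toKIdx) (E a : Matrix (Fin N) (Fin N) ℂ), r₂ < unitDistY x u v → (𝔡₂ x).form U (Pi.single v E) (Pi.single u a) = 0) →
        (∀ (u v : IBondY x.toKIdx) (E a : Matrix (Fin N) (Fin N) ℂ), ∑ z, ‖(𝔡₂ x).form U (Pi.single v E) (Pi.single u a) z‖ ≤ C₂ * ‖E‖ * ‖a‖) →
        (∀ B : IBondY x.toKIdx → Matrix (Fin N) (Fin N) ℂ, (∀ q, ¬ inΛstY x q → B q = 0) → (∀ q, IsAxialY x q → B q = 0) →
          (∀ c' : CBondStY x, Q1Y x (avYOfRecord x) U c'.1 B = 0) →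
          γ₀ * trIP (fun _ => (1 : ℝ)) B B ≤
            trIP (fun _ => (1 : ℝ)) B (deltaKPstY x (lettersYOfRecordV4P N θ Mstar (resYOfC2 N θ Mstar 𝔠) x) (sectEStYOfRecordV7 N θ Mstar 𝔢₀ x) U B)) →
      ∃ (Λ : Finset (B1Eq324BenfattoLemma.Site (θ.d₆ + 1 + (θ.d₆ + 1) + 1))) (e' : σ × TrIdx N ≃ ↥Λ),
        ((gaussianFieldOfKernel fun u w => if h : u ∈ Λ ∧ w ∈ Λ then
            ((Matrix.reindex e' e'
              (Matrix.of fun p q : σ × TrIdx N =>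
                  trReForm (trBasis N p.2) (((CsDeltaCPstY x (lettersYOfRecordV4P N θ Mstar (resYOfC2 N θ Mstar 𝔠) x)
            (sectEStYOfRecordV7 N θ Mstar 𝔢₀ x) U).restrictScalars ℝ)
                    (Pi.single (ι q.1) (trBasis N q.2)) (ι p.1))))⁻¹ :
                Matrix ↥Λ ↥Λ ℝ) ⟨u, h.1⟩ ⟨w, h.2⟩ else 0).map
            (fun (z : B1Eq324BenfattoLemma.Site (θ.d₆ + 1 + (θ.d₆ + 1) + 1) → ℝ) (q : σ × TrIdx N) => z ((e' q : ↥Λ) : B1Eq324BenfattoLemma.Site (θ.d₆ + 1 + (θ.d₆ + 1) + 1))) =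
          gaussianFieldOfKernel fun p q =>
            ((Matrix.of fun p q : σ × TrIdx N =>
                trReForm (trBasis N p.2) (((CsDeltaCPstY x (lettersYOfRecordV4P N θ Mstar (resYOfC2 N θ Mstar 𝔠) x)
            (sectEStYOfRecordV7 N θ Mstar 𝔢₀ x) U).restrictScalars ℝ)
                  (Pi.single (ι q.1) (trBasis N q.2)) (ι p.1)))⁻¹ :
              Matrix (σ × TrIdx N) (σ × TrIdx N) ℝ) p q) ∧
        (∀ p : ℝ, 0 ≤ p →
          ((fun (z : B1Eq324BenfattoLemma.Site (θ.d₆ + 1 + (θ.d₆ + 1) + 1) → ℝ) (q : σ × TrIdx N) => z ((e' q : ↥Λ) : B1Eq324BenfattoLemma.Site (θ.d₆ + 1 + (θ.d₆ + 1) + 1))) ⁻¹'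
              {ω : σ × TrIdx N → ℝ | ∀ q, |ω q| ≤ p}) =ᵐ[gaussianFieldOfKernel fun u w => if h : u ∈ Λ ∧ w ∈ Λ then
                ((Matrix.reindex e' e'
                  (Matrix.of fun p q : σ × TrIdx N =>
                      trReForm (trBasis N p.2) (((CsDeltaCPstY x (lettersYOfRecordV4P N θ Mstar (resYOfC2 N θ Mstar 𝔠) x)
            (sectEStYOfRecordV7 N θ Mstar 𝔢₀ x) U).restrictScalars ℝ)
                        (Pi.single (ι q.1) (trBasis N q.2)) (ι p.1))))⁻¹ :
                    Matrix ↥Λ ↥Λ ℝ) ⟨u, h.1⟩ ⟨w, h.2⟩ else 0]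
            smallFieldSet Λ p) ∧
        ∀ (s : ℕ) (I J : Finset (B1Eq324BenfattoLemma.Site (θ.d₆ + 1 + (θ.d₆ + 1) + 1))) (𝔞 : Coef (θ.d₆ + 1 + (θ.d₆ + 1) + 1)),
          I.Nonempty → J ⊆ I → J ⊆ Λ → coefSup s D 𝔞 J ≤ c * η ^ σ' →
          0 < ∫ z, cutoffBoltzmann (hamiltonian s D ϰ 𝔞 J) I (B10.pFun b₀ p₀ η) z ∂(gaussianFieldOfKernel fun u w => if h : u ∈ Λ ∧ w ∈ Λ then
              ((Matrix.reindex e' e'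
                (Matrix.of fun p q : σ × TrIdx N =>
                    trReForm (trBasis N p.2) (((CsDeltaCPstY x (lettersYOfRecordV4P N θ Mstar (resYOfC2 N θ Mstar 𝔠) x)
            (sectEStYOfRecordV7 N θ Mstar 𝔢₀ x) U).restrictScalars ℝ)
                      (Pi.single (ι q.1) (trBasis N q.2)) (ι p.1))))⁻¹ :
                  Matrix ↥Λ ↥Λ ℝ) ⟨u, h.1⟩ ⟨w, h.2⟩ else 0) ∧
            |Real.log (∫ z, cutoffBoltzmann (hamiltonian s D ϰ 𝔞 J) I (B10.pFun b₀ p₀ η) z ∂(gaussianFieldOfKernel fun u w =>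
                if h : u ∈ Λ ∧ w ∈ Λ then
                  ((Matrix.reindex e' e'
                    (Matrix.of fun p q : σ × TrIdx N =>
                        trReForm (trBasis N p.2) (((CsDeltaCPstY x (lettersYOfRecordV4P N θ Mstar (resYOfC2 N θ Mstar 𝔠) x)
            (sectEStYOfRecordV7 N θ Mstar 𝔢₀ x) U).restrictScalars ℝ)
                          (Pi.single (ι q.1) (trBasis N q.2)) (ι p.1))))⁻¹ :
                      Matrix ↥Λ ↥Λ ℝ) ⟨u, h.1⟩ ⟨w, h.2⟩ else 0)) -
              cumulantSum (gaussianFieldOfKernel fun u w => if h : u ∈ Λ ∧ w ∈ Λ then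
                  ((Matrix.reindex e' e'
                    (Matrix.of fun p q : σ × TrIdx N =>
                        trReForm (trBasis N p.2) (((CsDeltaCPstY x (lettersYOfRecordV4P N θ Mstar (resYOfC2 N θ Mstar 𝔠) x)
            (sectEStYOfRecordV7 N θ Mstar 𝔢₀ x) U).restrictScalars ℝ)
                          (Pi.single (ι q.1) (trBasis N q.2)) (ι p.1))))⁻¹ :
                      Matrix ↥Λ ↥Λ ℝ) ⟨u, h.1⟩ ⟨w, h.2⟩ else 0)
                (hamiltonian s D ϰ 𝔞 J) t| ≤ C * η ^ κ' * I.card := by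
  obtain ⟨b₁, hb₁⟩ := eq324_CsDeltaCPstY_lettersYOfRecordV4P_sectEStYOfRecordV7_trBasis_of_ineq3132_of_adjCurrentP_of_pivotLines_onΛst_on_unit N θ hD Mstar 𝔡₂
    (resYOfC2 N θ Mstar 𝔠) 𝔢₀ 𝔢st 𝔴 𝔈 (r₂ := r₂) hγ₀ hBP hδ hδV hj₁ hC₂ hsmall t D hϰ hp₀ hσ hc hκ hκσ
  refine ⟨b₁, fun b₀ hb₀ => ?_⟩
  obtain ⟨C, hC, hE⟩ := hb₁ b₀ hb₀
  refine ⟨C, hC, ?_⟩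
  intro η hη hηle x _ G hG U hU hV hCr hDr σ _ _ _ ι hι hιT h3132 hpin S hHJ hDsupp hDloc hDsz hco
  have hUu : ∀ μ z, U μ z ∈ unitaryUnits (Matrix (Fin N) (Fin N) ℂ) := fun μ z => hG (hU μ z)
  have hD2J : IsSymmTr (fun _ => (1 : ℝ)) ((𝔢₀ x).D2J U) := by
    rw [hpin]
    exact d2JOfY_GpPhysY_isSymmTr_of_real θ Mstar 𝔡₂ x hUu _ (resYOfC2_Δ2_isRealOpY θ Mstar 𝔠 x hUu hCr) hDr
  exact hE η hη hηle x hG U hU hV (resYOfC2_Δ2_isSymmTr_real θ Mstar 𝔠 x hUu hCr) hD2J ι hι hιT h3132 hpin S hHJ hDsupp hDloc hDsz hco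

/-- ★★★ **FAMILY FORM AT PRINT's CLASS over `𝔯 := resYOfC2 𝔠`** (p705447 §3's shape at print's objects: `h26` for the row-26 fields of
`opsYNuStOfRecordV4PE … (resYOfC2 𝔠) …` at `bg9YP`, print's thresholds, ONE rate `δ`). [cite: Balaban1985BackgroundPropagators, (3.132) p.422, (3.134) p.422, (3.136) p.422,
Thm 3.12 p.423, (3.35)–(3.36) p.396, (3.155)–(3.158) pp.427–428; Balaban1985Averaging, (125)–(126) p.36, (136) p.39; Balaban1984PropagatorsII, (2.149) p.249, (2.3) p.224,
Lemma 2.4 p.245; Balaban1985UV3, (24) p.262; Balaban1982Higgs1, (3.24) p.616; BenfattoEtAl1978, Lemma (4.5)–(4.7) p.152 (class form; bent window, presentation and coordinates ours)] -/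
theorem eq324_CsDeltaCPstY_lettersYOfRecordV4P_sectEStYOfRecordV7_trBasis_of_stmt3132Printed_P_of_adjCurrentP_of_pivotLines_ofC2_onΛst_on_unit (N : ℕ) [NeZero N]
    (θ : Stage3Params) (hD : 2 ≤ θ.d₆ + 1) (Mstar : ℕ) (𝔠 : C2Y N θ Mstar) (𝔡₂ : Dt2Y N θ Mstar)
    (𝔢₀ : SectEY N θ Mstar) (𝔢st : SectEStY N θ Mstar) (𝔴 : RWEY N θ Mstar) (𝔈 : ExpsY N θ Mstar) {c35 : ℝ}
    (h26 : B9.Stmt3132Printed (θ.d₆ + 1) c35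
      (geo9Y (d := θ.d₆) (ℓ := θ.ℓ₆) (hd := θ.hd') (hL := θ.hL') (b₀ := θ.b₀) (b₁ := θ.b₁) (Mstar := Mstar))
      (bg9YP (Matrix (Fin N) (Fin N) ℂ) (specialUnitaryUnits (Fin N)))
      (fun x => siteKernelP (opsYNuStOfRecordV4PE N θ Mstar (resYOfC2 N θ Mstar 𝔠) 𝔢st 𝔴 𝔈 x).QGQinv)
      (fun x => siteKernelP (opsYNuStOfRecordV4PE N θ Mstar (resYOfC2 N θ Mstar 𝔠) 𝔢st 𝔴 𝔈 x).QG1Qinv))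
    {γ₀ δV j₁ C₂ r₂ : ℝ} (hγ₀ : 0 < γ₀) (hδV : 0 ≤ δV) (hj₁ : 0 ≤ j₁) (hC₂ : 0 ≤ C₂)
    (hsmall : (θ.ℓ₆ : ℝ) * (2 * δV) < 1)
    (t D : ℕ) {ϰ : ℝ} (hϰ : 0 < ϰ) {p₀ σ' c κ' : ℝ} (hp₀ : 2 / 3 < p₀) (hσ : 0 < σ') (hc : 0 ≤ c) (hκ : 0 < κ') (hκσ : κ' < σ' * (t + 1)) :
    ∃ M₄ δ a₀ : ℝ, 0 < M₄ ∧ 0 < δ ∧ 0 < a₀ ∧ ∃ b₁ : ℝ, ∀ b₀ : ℝ, b₁ < b₀ → ∃ C : ℝ, 0 ≤ C ∧ ∀ η : ℝ, 0 < η → η ≤ 1 →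
      ∀ (x : MemberY θ.d₆ θ.ℓ₆ θ.hd' θ.hL' θ.b₀ θ.b₁ Mstar) [DecidableEq (IBondY x.toKIdx)], M₄ ≤ (geo9Y x).M →
      ∀ α₀ : ℝ, 0 < α₀ → (geo9Y x).M * α₀ ≤ a₀ →
      ∀ (U : CfgY (Matrix (Fin N) (Fin N) ℂ) x.toKIdx),
        (bg9YP (Matrix (Fin N) (Fin N) ℂ) (specialUnitaryUnits (Fin N)) x).Reg335 c35 α₀ U →
        (bg9YP (Matrix (Fin N) (Fin N) ℂ) (specialUnitaryUnits (Fin N)) x).Reg336 c35 α₀ U →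
        (∀ c' : CBondStY x, ¬ GoodY x c'.1.1 → ∀ i : ℕ, i < θ.ℓ₆ →
          ‖((avYOfRecord x U ⟨ofZ x (labK x c'.1.1 + (i : ℤ) • unitVec c'.1.2), c'.1.2⟩ : (Matrix (Fin N) (Fin N) ℂ)ˣ) :
              Matrix (Fin N) (Fin N) ℂ) - 1‖ ≤ δV) →
        (∀ A A' : FBondY x.toKIdx → Matrix (Fin N) (Fin N) ℂ, (𝔠 x).form U (star A) (star A') = star ((𝔠 x).form U A A')) →
        (∀ B B' : IBondY x.toKIdx → Matrix (Fin N) (Fin N) ℂ, (𝔡₂ x).form U (star B) (star B') = star ((𝔡₂ x).form U B B')) →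
      ∀ {σ : Type} [Fintype σ] [DecidableEq σ] [Nonempty σ] (ι : σ → IBondY x.toKIdx), Function.Injective ι → (∀ s, lamTstY x (ι s)) →
        (𝔢₀ x).D2J U = d2JOfY (trDualMatY N) x.toKIdx (parSymY x.toKIdx) (parBY x.toKIdx) (GpPhysY x.toKIdx (parSymY x.toKIdx)) (resYOfC2 N θ Mstar 𝔠 x).Δ2
          (𝔡₂ x).form U →
      ∀ (S : IBondY x.toKIdx → Prop),
        (∀ z, S z → etaDY x * ‖trAdjY (trDualMatY N)
          (H1Y x.toKIdx (parSymY x.toKIdx) (parBY x.toKIdx) (GpPhysY x.toKIdx (parSymY x.toKIdx)) (resYOfC2 N θ Mstar 𝔠 x).Δ2 U) (JY x.toKIdx U) z‖ ≤ j₁) →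
        (∀ (u v : IBondY x.toKIdx) (E a : Matrix (Fin N) (Fin N) ℂ) (z : IBondY x.toKIdx), inΛstY x u → inΛstY x v →
          (𝔡₂ x).form U (Pi.single v E) (Pi.single u a) z ≠ 0 → S z) →
        (∀ (u v : IBondY x.toKIdx) (E a : Matrix (Fin N) (Fin N) ℂ), r₂ < unitDistY x u v → (𝔡₂ x).form U (Pi.single v E) (Pi.single u a) = 0) →
        (∀ (u v : IBondY x.toKIdx) (E a : Matrix (Fin N) (Fin N) ℂ), ∑ z, ‖(𝔡₂ x).form U (Pi.single v E) (Pi.single u a) z‖ ≤ C₂ * ‖E‖ * ‖a‖) →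
        (∀ B : IBondY x.toKIdx → Matrix (Fin N) (Fin N) ℂ, (∀ q, ¬ inΛstY x q → B q = 0) → (∀ q, IsAxialY x q → B q = 0) →
          (∀ c' : CBondStY x, Q1Y x (avYOfRecord x) U c'.1 B = 0) →
          γ₀ * trIP (fun _ => (1 : ℝ)) B B ≤
            trIP (fun _ => (1 : ℝ)) B (deltaKPstY x (lettersYOfRecordV4P N θ Mstar (resYOfC2 N θ Mstar 𝔠) x) (sectEStYOfRecordV7 N θ Mstar 𝔢₀ x) U B)) →
      ∃ (Λ : Finset (B1Eq324BenfattoLemma.Site (θ.d₆ + 1 + (θ.d₆ + 1) + 1))) (e' : σ × TrIdx N ≃ ↥Λ),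
        ((gaussianFieldOfKernel fun u w => if h : u ∈ Λ ∧ w ∈ Λ then
            ((Matrix.reindex e' e'
              (Matrix.of fun p q : σ × TrIdx N =>
                  trReForm (trBasis N p.2) (((CsDeltaCPstY x (lettersYOfRecordV4P N θ Mstar (resYOfC2 N θ Mstar 𝔠) x)
            (sectEStYOfRecordV7 N θ Mstar 𝔢₀ x) U).restrictScalars ℝ)
                    (Pi.single (ι q.1) (trBasis N q.2)) (ι p.1))))⁻¹ :
                Matrix ↥Λ ↥Λ ℝ) ⟨u, h.1⟩ ⟨w, h.2⟩ else 0).map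
            (fun (z : B1Eq324BenfattoLemma.Site (θ.d₆ + 1 + (θ.d₆ + 1) + 1) → ℝ) (q : σ × TrIdx N) => z ((e' q : ↥Λ) : B1Eq324BenfattoLemma.Site (θ.d₆ + 1 + (θ.d₆ + 1) + 1))) =
          gaussianFieldOfKernel fun p q =>
            ((Matrix.of fun p q : σ × TrIdx N =>
                trReForm (trBasis N p.2) (((CsDeltaCPstY x (lettersYOfRecordV4P N θ Mstar (resYOfC2 N θ Mstar 𝔠) x)
            (sectEStYOfRecordV7 N θ Mstar 𝔢₀ x) U).restrictScalars ℝ)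
                  (Pi.single (ι q.1) (trBasis N q.2)) (ι p.1)))⁻¹ :
              Matrix (σ × TrIdx N) (σ × TrIdx N) ℝ) p q) ∧
        (∀ p : ℝ, 0 ≤ p →
          ((fun (z : B1Eq324BenfattoLemma.Site (θ.d₆ + 1 + (θ.d₆ + 1) + 1) → ℝ) (q : σ × TrIdx N) => z ((e' q : ↥Λ) : B1Eq324BenfattoLemma.Site (θ.d₆ + 1 + (θ.d₆ + 1) + 1))) ⁻¹'
              {ω : σ × TrIdx N → ℝ | ∀ q, |ω q| ≤ p}) =ᵐ[gaussianFieldOfKernel fun u w => if h : u ∈ Λ ∧ w ∈ Λ then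
                ((Matrix.reindex e' e'
                  (Matrix.of fun p q : σ × TrIdx N =>
                      trReForm (trBasis N p.2) (((CsDeltaCPstY x (lettersYOfRecordV4P N θ Mstar (resYOfC2 N θ Mstar 𝔠) x)
            (sectEStYOfRecordV7 N θ Mstar 𝔢₀ x) U).restrictScalars ℝ)
                        (Pi.single (ι q.1) (trBasis N q.2)) (ι p.1))))⁻¹ :
                    Matrix ↥Λ ↥Λ ℝ) ⟨u, h.1⟩ ⟨w, h.2⟩ else 0]
            smallFieldSet Λ p) ∧
        ∀ (s : ℕ) (I J : Finset (B1Eq324BenfattoLemma.Site (θ.d₆ + 1 + (θ.d₆ + 1) + 1))) (𝔞 : Coef (θ.d₆ + 1 + (θ.d₆ + 1) + 1)),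
          I.Nonempty → J ⊆ I → J ⊆ Λ → coefSup s D 𝔞 J ≤ c * η ^ σ' →
          0 < ∫ z, cutoffBoltzmann (hamiltonian s D ϰ 𝔞 J) I (B10.pFun b₀ p₀ η) z ∂(gaussianFieldOfKernel fun u w => if h : u ∈ Λ ∧ w ∈ Λ then
              ((Matrix.reindex e' e'
                (Matrix.of fun p q : σ × TrIdx N =>
                    trReForm (trBasis N p.2) (((CsDeltaCPstY x (lettersYOfRecordV4P N θ Mstar (resYOfC2 N θ Mstar 𝔠) x)
            (sectEStYOfRecordV7 N θ Mstar 𝔢₀ x) U).restrictScalars ℝ)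
                      (Pi.single (ι q.1) (trBasis N q.2)) (ι p.1))))⁻¹ :
                  Matrix ↥Λ ↥Λ ℝ) ⟨u, h.1⟩ ⟨w, h.2⟩ else 0) ∧
            |Real.log (∫ z, cutoffBoltzmann (hamiltonian s D ϰ 𝔞 J) I (B10.pFun b₀ p₀ η) z ∂(gaussianFieldOfKernel fun u w =>
                if h : u ∈ Λ ∧ w ∈ Λ then
                  ((Matrix.reindex e' e'
                    (Matrix.of fun p q : σ × TrIdx N =>
                        trReForm (trBasis N p.2) (((CsDeltaCPstY x (lettersYOfRecordV4P N θ Mstar (resYOfC2 N θ Mstar 𝔠) x)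
            (sectEStYOfRecordV7 N θ Mstar 𝔢₀ x) U).restrictScalars ℝ)
                          (Pi.single (ι q.1) (trBasis N q.2)) (ι p.1))))⁻¹ :
                      Matrix ↥Λ ↥Λ ℝ) ⟨u, h.1⟩ ⟨w, h.2⟩ else 0)) -
              cumulantSum (gaussianFieldOfKernel fun u w => if h : u ∈ Λ ∧ w ∈ Λ then
                  ((Matrix.reindex e' e'
                    (Matrix.of fun p q : σ × TrIdx N =>
                        trReForm (trBasis N p.2) (((CsDeltaCPstY x (lettersYOfRecordV4P N θ Mstar (resYOfC2 N θ Mstar 𝔠) x)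
            (sectEStYOfRecordV7 N θ Mstar 𝔢₀ x) U).restrictScalars ℝ)
                          (Pi.single (ι q.1) (trBasis N q.2)) (ι p.1))))⁻¹ :
                      Matrix ↥Λ ↥Λ ℝ) ⟨u, h.1⟩ ⟨w, h.2⟩ else 0)
                (hamiltonian s D ϰ 𝔞 J) t| ≤ C * η ^ κ' * I.card := by
  obtain ⟨M₄, δ, a₀, BP, hM₄, hδ, ha₀, hBP, H⟩ := h26
  obtain ⟨b₁, hb₁⟩ := eq324_CsDeltaCPstY_lettersYOfRecordV4P_sectEStYOfRecordV7_trBasis_of_ineq3132_of_adjCurrentP_of_pivotLines_ofC2_onΛst_on_unit N θ hD Mstar 𝔠 𝔡₂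
    𝔢₀ 𝔢st 𝔴 𝔈 (r₂ := r₂) hγ₀ hBP.le hδ hδV hj₁ hC₂ hsmall t D hϰ hp₀ hσ hc hκ hκσ
  refine ⟨M₄, δ, a₀, hM₄, hδ, ha₀, b₁, fun b₀ hb₀ => ?_⟩
  obtain ⟨C, hC, hE⟩ := hb₁ b₀ hb₀
  refine ⟨C, hC, ?_⟩
  intro η hη hηle x _ hMx α₀ hα₀ hMa U h335 h336 hV hCr hDr σ _ _ _ ι hι hιT hpin S hHJ hDsupp hDloc hDsz hco
  exact hE η hη hηle x specialUnitaryUnits_le_unitaryUnits U (B9BackgroundsKLevelV1P.mem_of_reg335P x.toKIdx h335.1) hV hCr hDr ι hι hιT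
    (H x hMx α₀ hα₀ hMa U h335 h336).2 hpin S hHJ hDsupp hDloc hDsz hco

/-- ★★★★ **THE STAR DOOR OF RECORD MODULO NODE N06's SOCKET OF RECORD, over `𝔯 := resYOfC2 𝔠`, EVERY ROW AT PRINT's OBJECTS** — from
`h06 : B9LeafX (Y9OfRecordP N θ M⋆ (opsYNuStOfRecordV4PE N θ M⋆ (resYOfC2 N θ M⋆ 𝔠) 𝔢st 𝔴 𝔈))`; displayed per background: the pivot-line smallness of `V` (NODE 00's
dictionary deviation), [5]'s LETTER reality of `C⁽²⁾(U)` and `D̃⁽²⁾(U)`, the PIN of `(𝔢₀ x).D2J` to [5]'s form at print's `H₁`, (b†) the adjoint-current sup of print's `H₁(U)`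
on `S` (node N06's (3.136) content, not a leaf field), (c-out)∕(c) the `D̃⁽²⁾` rows, the Δ_k-row `γ₀` (G-B9-09).  What stands between this door and N08's row `h324c` is
node N06's certificate (`h06`), node N06's (3.136), [5]'s letters, G-B9-09 and the IDENT — nothing of NODE 00 but the booked transport-comb edition.
[cite: Balaban1985BackgroundPropagators, (3.132) p.422, (3.134) p.422, (3.136) p.422, Thm 3.12 p.423, (3.35)–(3.36) p.396, (3.155)–(3.158) pp.427–428, Thms 3.1–3.15 pp.397–432;
Balaban1984PropagatorsII, (2.149) p.249, (2.3) p.224, Lemma 2.4 p.245; Balaban1985Averaging, (125)–(126) p.36, (136) p.39; Balaban1985UV3, (24) p.262, pp.271–272;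
Balaban1982Higgs1, (3.24) p.616; BenfattoEtAl1978, Lemma (4.5)–(4.7) p.152 (class form; bent window, presentation and coordinates ours)] -/
theorem eq324_CsDeltaCPstY_lettersYOfRecordV4P_sectEStYOfRecordV7_trBasis_of_b9LeafX_of_adjCurrentP_of_pivotLines_ofC2_onΛst_on_unit (N : ℕ) [NeZero N]
    (θ : Stage3Params) (hD : 2 ≤ θ.d₆ + 1) (Mstar : ℕ) (𝔠 : C2Y N θ Mstar) (𝔡₂ : Dt2Y N θ Mstar)
    (𝔢₀ : SectEY N θ Mstar) (𝔢st : SectEStY N θ Mstar) (𝔴 : RWEY N θ Mstar) (𝔈 : ExpsY N θ Mstar) 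
    (h06 : B9LeafX (Y9OfRecordP N θ Mstar (opsYNuStOfRecordV4PE N θ Mstar (resYOfC2 N θ Mstar 𝔠) 𝔢st 𝔴 𝔈)))
    {γ₀ δV j₁ C₂ r₂ : ℝ} (hγ₀ : 0 < γ₀) (hδV : 0 ≤ δV) (hj₁ : 0 ≤ j₁) (hC₂ : 0 ≤ C₂)
    (hsmall : (θ.ℓ₆ : ℝ) * (2 * δV) < 1)
    (t D : ℕ) {ϰ : ℝ} (hϰ : 0 < ϰ) {p₀ σ' c κ' : ℝ} (hp₀ : 2 / 3 < p₀) (hσ : 0 < σ') (hc : 0 ≤ c) (hκ : 0 < κ') (hκσ : κ' < σ' * (t + 1)) :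
    ∃ M₄ δ a₀ : ℝ, 0 < M₄ ∧ 0 < δ ∧ 0 < a₀ ∧ ∃ b₁ : ℝ, ∀ b₀ : ℝ, b₁ < b₀ → ∃ C : ℝ, 0 ≤ C ∧ ∀ η : ℝ, 0 < η → η ≤ 1 →
      ∀ (x : MemberY θ.d₆ θ.ℓ₆ θ.hd' θ.hL' θ.b₀ θ.b₁ Mstar) [DecidableEq (IBondY x.toKIdx)], M₄ ≤ (geo9Y x).M →
      ∀ α₀ : ℝ, 0 < α₀ → (geo9Y x).M * α₀ ≤ a₀ →
      ∀ (U : CfgY (Matrix (Fin N) (Fin N) ℂ) x.toKIdx),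
        (bg9YP (Matrix (Fin N) (Fin N) ℂ) (specialUnitaryUnits (Fin N)) x).Reg335 B9PinGeometryKLevelV1.c35Y α₀ U →
        (bg9YP (Matrix (Fin N) (Fin N) ℂ) (specialUnitaryUnits (Fin N)) x).Reg336 B9PinGeometryKLevelV1.c35Y α₀ U →
        (∀ c' : CBondStY x, ¬ GoodY x c'.1.1 → ∀ i : ℕ, i < θ.ℓ₆ →
          ‖((avYOfRecord x U ⟨ofZ x (labK x c'.1.1 + (i : ℤ) • unitVec c'.1.2), c'.1.2⟩ : (Matrix (Fin N) (Fin N) ℂ)ˣ) :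
              Matrix (Fin N) (Fin N) ℂ) - 1‖ ≤ δV) →
        (∀ A A' : FBondY x.toKIdx → Matrix (Fin N) (Fin N) ℂ, (𝔠 x).form U (star A) (star A') = star ((𝔠 x).form U A A')) →
        (∀ B B' : IBondY x.toKIdx → Matrix (Fin N) (Fin N) ℂ, (𝔡₂ x).form U (star B) (star B') = star ((𝔡₂ x).form U B B')) →
      ∀ {σ : Type} [Fintype σ] [DecidableEq σ] [Nonempty σ] (ι : σ → IBondY x.toKIdx), Function.Injective ι → (∀ s, lamTstY x (ι s)) →
        (𝔢₀ x).D2J U = d2JOfY (trDualMatY N) x.toKIdx (parSymY x.toKIdx) (parBY x.toKIdx) (GpPhysY x.toKIdx (parSymY x.toKIdx)) (resYOfC2 N θ Mstar 𝔠 x).Δ2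
          (𝔡₂ x).form U →
      ∀ (S : IBondY x.toKIdx → Prop),
        (∀ z, S z → etaDY x * ‖trAdjY (trDualMatY N)
          (H1Y x.toKIdx (parSymY x.toKIdx) (parBY x.toKIdx) (GpPhysY x.toKIdx (parSymY x.toKIdx)) (resYOfC2 N θ Mstar 𝔠 x).Δ2 U) (JY x.toKIdx U) z‖ ≤ j₁) →
        (∀ (u v : IBondY x.toKIdx) (E a : Matrix (Fin N) (Fin N) ℂ) (z : IBondY x.toKIdx), inΛstY x u → inΛstY x v →
          (𝔡₂ x).form U (Pi.single v E) (Pi.single u a) z ≠ 0 → S z) →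
        (∀ (u v : IBondY x.toKIdx) (E a : Matrix (Fin N) (Fin N) ℂ), r₂ < unitDistY x u v → (𝔡₂ x).form U (Pi.single v E) (Pi.single u a) = 0) →
        (∀ (u v : IBondY x.toKIdx) (E a : Matrix (Fin N) (Fin N) ℂ), ∑ z, ‖(𝔡₂ x).form U (Pi.single v E) (Pi.single u a) z‖ ≤ C₂ * ‖E‖ * ‖a‖) →
        (∀ B : IBondY x.toKIdx → Matrix (Fin N) (Fin N) ℂ, (∀ q, ¬ inΛstY x q → B q = 0) → (∀ q, IsAxialY x q → B q = 0) →
          (∀ c' : CBondStY x, Q1Y x (avYOfRecord x) U c'.1 B = 0) →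
          γ₀ * trIP (fun _ => (1 : ℝ)) B B ≤
            trIP (fun _ => (1 : ℝ)) B (deltaKPstY x (lettersYOfRecordV4P N θ Mstar (resYOfC2 N θ Mstar 𝔠) x) (sectEStYOfRecordV7 N θ Mstar 𝔢₀ x) U B)) →
      ∃ (Λ : Finset (B1Eq324BenfattoLemma.Site (θ.d₆ + 1 + (θ.d₆ + 1) + 1))) (e' : σ × TrIdx N ≃ ↥Λ),
        ((gaussianFieldOfKernel fun u w => if h : u ∈ Λ ∧ w ∈ Λ then
            ((Matrix.reindex e' e'
              (Matrix.of fun p q : σ × TrIdx N =>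
                  trReForm (trBasis N p.2) (((CsDeltaCPstY x (lettersYOfRecordV4P N θ Mstar (resYOfC2 N θ Mstar 𝔠) x)
            (sectEStYOfRecordV7 N θ Mstar 𝔢₀ x) U).restrictScalars ℝ)
                    (Pi.single (ι q.1) (trBasis N q.2)) (ι p.1))))⁻¹ :
                Matrix ↥Λ ↥Λ ℝ) ⟨u, h.1⟩ ⟨w, h.2⟩ else 0).map
            (fun (z : B1Eq324BenfattoLemma.Site (θ.d₆ + 1 + (θ.d₆ + 1) + 1) → ℝ) (q : σ × TrIdx N) => z ((e' q : ↥Λ) : B1Eq324BenfattoLemma.Site (θ.d₆ + 1 + (θ.d₆ + 1) + 1))) =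
          gaussianFieldOfKernel fun p q =>
            ((Matrix.of fun p q : σ × TrIdx N =>
                trReForm (trBasis N p.2) (((CsDeltaCPstY x (lettersYOfRecordV4P N θ Mstar (resYOfC2 N θ Mstar 𝔠) x)
            (sectEStYOfRecordV7 N θ Mstar 𝔢₀ x) U).restrictScalars ℝ)
                  (Pi.single (ι q.1) (trBasis N q.2)) (ι p.1)))⁻¹ :
              Matrix (σ × TrIdx N) (σ × TrIdx N) ℝ) p q) ∧
        (∀ p : ℝ, 0 ≤ p →
          ((fun (z : B1Eq324BenfattoLemma.Site (θ.d₆ + 1 + (θ.d₆ + 1) + 1) → ℝ) (q : σ × TrIdx N) => z ((e' q : ↥Λ) : B1Eq324BenfattoLemma.Site (θ.d₆ + 1 + (θ.d₆ + 1) + 1))) ⁻¹'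
              {ω : σ × TrIdx N → ℝ | ∀ q, |ω q| ≤ p}) =ᵐ[gaussianFieldOfKernel fun u w => if h : u ∈ Λ ∧ w ∈ Λ then
                ((Matrix.reindex e' e'
                  (Matrix.of fun p q : σ × TrIdx N =>
                      trReForm (trBasis N p.2) (((CsDeltaCPstY x (lettersYOfRecordV4P N θ Mstar (resYOfC2 N θ Mstar 𝔠) x)
            (sectEStYOfRecordV7 N θ Mstar 𝔢₀ x) U).restrictScalars ℝ)
                        (Pi.single (ι q.1) (trBasis N q.2)) (ι p.1))))⁻¹ :
                    Matrix ↥Λ ↥Λ ℝ) ⟨u, h.1⟩ ⟨w, h.2⟩ else 0]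
            smallFieldSet Λ p) ∧
        ∀ (s : ℕ) (I J : Finset (B1Eq324BenfattoLemma.Site (θ.d₆ + 1 + (θ.d₆ + 1) + 1))) (𝔞 : Coef (θ.d₆ + 1 + (θ.d₆ + 1) + 1)),
          I.Nonempty → J ⊆ I → J ⊆ Λ → coefSup s D 𝔞 J ≤ c * η ^ σ' →
          0 < ∫ z, cutoffBoltzmann (hamiltonian s D ϰ 𝔞 J) I (B10.pFun b₀ p₀ η) z ∂(gaussianFieldOfKernel fun u w => if h : u ∈ Λ ∧ w ∈ Λ then
              ((Matrix.reindex e' e'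
                (Matrix.of fun p q : σ × TrIdx N =>
                    trReForm (trBasis N p.2) (((CsDeltaCPstY x (lettersYOfRecordV4P N θ Mstar (resYOfC2 N θ Mstar 𝔠) x)
            (sectEStYOfRecordV7 N θ Mstar 𝔢₀ x) U).restrictScalars ℝ)
                      (Pi.single (ι q.1) (trBasis N q.2)) (ι p.1))))⁻¹ :
                  Matrix ↥Λ ↥Λ ℝ) ⟨u, h.1⟩ ⟨w, h.2⟩ else 0) ∧
            |Real.log (∫ z, cutoffBoltzmann (hamiltonian s D ϰ 𝔞 J) I (B10.pFun b₀ p₀ η) z ∂(gaussianFieldOfKernel fun u w =>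
                if h : u ∈ Λ ∧ w ∈ Λ then
                  ((Matrix.reindex e' e'
                    (Matrix.of fun p q : σ × TrIdx N =>
                        trReForm (trBasis N p.2) (((CsDeltaCPstY x (lettersYOfRecordV4P N θ Mstar (resYOfC2 N θ Mstar 𝔠) x)
            (sectEStYOfRecordV7 N θ Mstar 𝔢₀ x) U).restrictScalars ℝ)
                          (Pi.single (ι q.1) (trBasis N q.2)) (ι p.1))))⁻¹ :
                      Matrix ↥Λ ↥Λ ℝ) ⟨u, h.1⟩ ⟨w, h.2⟩ else 0)) -
              cumulantSum (gaussianFieldOfKernel fun u w => if h : u ∈ Λ ∧ w ∈ Λ then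
                  ((Matrix.reindex e' e'
                    (Matrix.of fun p q : σ × TrIdx N =>
                        trReForm (trBasis N p.2) (((CsDeltaCPstY x (lettersYOfRecordV4P N θ Mstar (resYOfC2 N θ Mstar 𝔠) x)
            (sectEStYOfRecordV7 N θ Mstar 𝔢₀ x) U).restrictScalars ℝ)
                          (Pi.single (ι q.1) (trBasis N q.2)) (ι p.1))))⁻¹ :
                      Matrix ↥Λ ↥Λ ℝ) ⟨u, h.1⟩ ⟨w, h.2⟩ else 0)
                (hamiltonian s D ϰ 𝔞 J) t| ≤ C * η ^ κ' * I.card :=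
  eq324_CsDeltaCPstY_lettersYOfRecordV4P_sectEStYOfRecordV7_trBasis_of_stmt3132Printed_P_of_adjCurrentP_of_pivotLines_ofC2_onΛst_on_unit N θ hD Mstar 𝔠 𝔡₂ 𝔢₀
    𝔢st 𝔴 𝔈 h06.s3132 hγ₀ hδV hj₁ hC₂ hsmall t D hϰ hp₀ hσ hc hκ hκσ

end DoorsC2

end Literature.MathematicalPhysics.QuantumFieldTheory.Balaban1983to89.B1Eq324BenfattoClassSectEMemberPrecisionDoorRecordV4PAdjCurrent

end
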